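import Literature.Probability.RandomPlanarGeometry.YangBaxterSAWExcursionJordan
import Literature.Probability.RandomPlanarGeometry.YangBaxterSAWYBE
import Literature.Barriers.CriticalPhenomena.PlaquetteWalkSeparatedExits
import Literature.Barriers.CriticalPhenomena.PlaquetteWalkIsthmusDichotomy
import HarnessLib

/-!
# The root-plaquette defect law of the Yang–Baxter vertex functional for arbitrary (hole) roots

Topic `Literature/Barriers/CriticalPhenomena` (barrier catalogue, plaquette-walk Yang–Baxter identity; venture lane
«pcv-sawmu», Tier B). Sequel to `YangBaxterSAWUnwoundPlaquette.lean` (Glazman–Manolescu's Lemma 2.1 at one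
rhombus: the signed class expansion of the vertex functional at the root's own plaquette,
`vertexFunctional_printed_root_plaquette_eq_class_sum`, and Lemma E `backBracket_cone_W/E/S/N`) and
`YangBaxterSAWExcursionJordan.lean` (the excursion polygon is a simple closed polygon; the sign rule
`ΩG.AJ_midPt_side_eq`). Combining them:

* `backBracket_swap`, `re_rootUnit_mul_chordSign_mul_backBracket_ge` — Lemma E for both orientations of every
  class: the 24 signed class directions `ε(σ; z₁, z₂)·backBracket(θ; σ, z₁, z₂, z₃)` of a root side `σ`, rotated by
  the unit `rootUnit θ σ`, have real part `≥ v(θ)·cos(π/8)`;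
* `ΩG.sign_law_root` — at the root's own plaquette every class-`B2a` walk is unwound (`WE = excursionWinding`)
  or wound exactly once with the sign of the chord rule: `WE - excursionWinding = 4π·ε(σ; exit, return)` and the
  group sign `sin((5/8)(WE - excursionWinding))` equals `ε`;
* ★ `PlaquetteWalk.vertexFunctional_printed_root_plaquette_defect_law` — for every `θ ∈ [π/3, 2π/3]`, finite face
  list, plaquette `w`, side `σ` with `w.side σ` non-interior:
  `‖VF_D(w.side σ, w)‖ ≥ v(θ)·cos(π/8)·Σ_{ω ∈ B2a(w)} woundMass ω` (total exterior weight of the wound walks);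
* ★ `PlaquetteWalk.vertexFunctional_printed_root_plaquette_eq_zero_iff` — THE WOUND-WALK DICHOTOMY:
  `VF_D(w.side σ, w) = 0 ↔` every class-`B2a` walk at `w` is unwound or has exterior weight `0`
  (`ΩG.woundMass_eq_zero_iff`). Isthmus roots (Part 4, `PlaquetteWalkIsthmusDichotomy.lean`), «pocket» hole
  roots (no class-`B2a` walk at `w`) and outer roots are the known instances; the new content is hole roots with
  THICK walls, where no cancellation between winding classes can occur;
* ★ `PlaquetteWalk.vertexFunctional_printed_root_plaquette_eq_zero_iff_unwound` — on the OPEN range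
  `θ ∈ (π/3, 2π/3)` (all five weights positive, `YBWalk.extWeight_pos`): `VF_D(w.side σ, w) = 0 ↔` every
  class-`B2a` walk at `w` is unwound;
* `norm_backBracket` (every backward half-bracket has modulus `v(θ)`, all 24 ordered classes) and the UPPER bound
  `PlaquetteWalk.norm_vertexFunctional_printed_root_plaquette_le`: `‖VF_D(w.side σ, w)‖ ≤ v(θ)·Σ woundMass` — so the
  modulus of the root-plaquette defect is pinned between `v cos(π/8)` and `v` times the wound mass.

* (edition 7, § Parity) `ΩG.rayCount_rev`, ★ `ΩG.WE_eq_excursionWinding_iff_even_rayCount` (at the root's own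
  plaquette: unwound ↔ the excursion crosses the lattice half-line behind `σ` an even number of times — the winding
  parity law of `YangBaxterSAWExcursionJordan.lean`, Part P), ★★ `PlaquetteWalk.vertexFunctional_printed_root_
  plaquette_eq_zero_iff_forall_even_rayCount` / `…_ne_zero_iff_exists_odd_rayCount` (open range) and
  `…_eq_zero_iff_forall_even_rayCount_or` (closed range, weight-zero clause): (Q2′) as a DECIDABLE condition —
  `VF_D(w.side σ, w) ≠ 0 ↔` some class-`B2a` walk at `w` has an odd ray count.
* (edition 7, § Odd crossing) `isB2a_consWalk`, `rayCount_consWalk`, ★★★ `PlaquetteWalk.vertexFunctional_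
  printed_root_plaquette_ne_zero_of_odd_crossing` — THE ODD-CROSSING CRITERION: if some self-avoiding plaquette walk
  of `D ∖ {w}` between two distinct sides of `w` crosses the lattice half-line behind `σ` an odd number of times
  (e.g. a simple closed chain of plaquettes through `w` winding once around the hole cell), then
  `VF_D(w.side σ, w) ≠ 0` for every `θ ∈ (π/3, 2π/3)` (new import: `PlaquetteWalkSeparatedExits`, for `consWalk`
  of `PlaquetteWalkIsthmusRoot` and `eq_nbr_of_side_eq_side`; `rootedFace_of_boundaryRoot`).
* (edition 7, § Excursion) `excursionWalk` (the excursion of a class-`B2a` walk at the root's own plaquette as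
  a walk of `D ∖ {w}`), `rayCount_eq_card_filter_excursionWalk`, ★★★ `PlaquetteWalk.vertexFunctional_printed_
  root_plaquette_ne_zero_iff_exists_odd_crossing` — THE CRITERION IS SHARP: on the open range `VF_D(w.side σ, w) ≠ 0`
  iff some self-avoiding plaquette walk of `D ∖ {w}` between two distinct sides of `w` crosses the half-line behind
  `σ` an odd number of times.
* (edition 7, § D43) `D43`, `δ43`, `δ43_rayCount`, ★★ `PlaquetteWalk.vertexFunctional_printed_D43_root_ne_zero` — the
  lane's counterexample to the naive face-cycle criterion, in the kernel: on the explicit 43-face domain `D43` the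
  identity fails at the hole root `((0,-1), N)` for EVERY `θ ∈ (π/3, 2π/3)` (odd-crossing criterion on an explicit
  43-arc walk checked by `decide`), although the root plaquette lies on no simple plaquette cycle around its hole.

* (edition 8, § Isthmus) `PlaquetteWalk.exists_woundMass_ne_zero_of_isthmus_hole_root` and
  ★ `PlaquetteWalk.exists_odd_rayCount_of_isthmus_hole_root` — consistency with Part 4
  (`PlaquetteWalkIsthmusDichotomy.vertexFunctional_printed_isthmus_root_ne_zero_of_not_outerRoot`): at every
  GENUINE ISTHMUS hole root (the plaquette behind `σ` missing, the root across `σ.opp` outer, the root itself not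
  outer) some class-`B2a` walk at the root plaquette has nonzero wound mass (closed range) and, on the open range,
  an ODD ray count — the slot-walk world of Parts 1–4 and the excursion world of this file agree (new import:
  `PlaquetteWalkIsthmusDichotomy`).

References: A. Glazman, I. Manolescu, arXiv:1708.00395v3, Lemma 2.1 and its proof [GlazmanManolescu2019];
H. Duminil-Copin, S. Smirnov, Ann. of Math. 175 (2012), Lemma 1 and its proof [DuminilCopinSmirnov2012];
A. Glazman, Electron. Commun. Probab. 20 (2015) no. 86, Lemma 3.1 [Glazman2015WeightedSAW]; the even–odd rule:
R. Courant, H. Robbins, *What is Mathematics?*, Ch. V Appendix §2 [CourantRobbins1958].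

Editions: editions 1–6 (b-step0 gen 15) = Part X; edition 7 (b-step0 gen 16) = edition 6 verbatim (+ one import, `PlaquetteWalkSeparatedExits`) ⊕ the appended § Parity, § Odd crossing, § Excursion and § D43; edition 8 (b-step0 gen 16) = edition 7 verbatim
(+ one import, `PlaquetteWalkIsthmusDichotomy`) ⊕ the appended § Isthmus (the isthmus-consistency corollaries).
-/

noncomputable section

/-! ## Part X. The root-plaquette defect law for ARBITRARY non-interior roots (thick walls included)

The sign rule (`ΩG.AJ_midPt_side_eq`) turns the signed class expansion of the vertex functional at the root's
own plaquette (`PlaquetteWalk.vertexFunctional_printed_root_plaquette_eq_class_sum`) into a sum of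
non-negative masses along explicit directions all lying in one open half-plane (Lemma E:
`backBracket_cone_W/E/S/N`, extended to both orientations of every class by `backBracket_swap`), whence
`‖VF_D(w.side σ, w)‖ ≥ v(θ)·cos(π/8)·(total exterior weight of the WOUND class-B2a walks at w)` and
`VF_D(w.side σ, w) = 0 ⟺` every class-`B2a` walk at `w` is unwound or has exterior weight `0`. -/

namespace Literature.Probability.RandomPlanarGeometry.SAW.YangBaxter

open Real Complex

/-- **Reversing the excursion negates the backward half-bracket** (the forward half at the tabulated winding
is minus the backward half, `groupTwo_gen`, and reversal exchanges them, `excursionWinding_swap`).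
[cite: GlazmanManolescu2019, Lemma 2.1 (statement, "in the form given in [Gl]")] [cite: Glazman2015WeightedSAW, Lemma 3.1 (proof, p. 6)] -/
theorem backBracket_swap (θ : ℝ) {z₀ z₁ z₂ z₃ : Side} (h01 : z₀ ≠ z₁) (h02 : z₀ ≠ z₂) (h03 : z₀ ≠ z₃)
    (h12 : z₁ ≠ z₂) (h13 : z₁ ≠ z₃) (h23 : z₂ ≠ z₃) :
    backBracket θ z₀ z₂ z₁ z₃ = -backBracket θ z₀ z₁ z₂ z₃ := by
  have h0 := groupTwo_gen θ z₀ z₁ z₂ z₃ h01 h02 h03 h12 h13 h23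
  unfold bracket at h0
  unfold backBracket
  rw [excursionWinding_swap θ z₀ z₁ z₂, sub_neg_eq_add]
  linear_combination h0

/-- The unit complex number rotating the class directions of the root side `σ` into the right half-plane
(`i`, `-i`, `i e^{-iθ}`, `-i e^{-iθ}` for `W, E, S, N`). [folklore] -/
def rootUnit (θ : ℝ) : Side → ℂ
  | .W => Complex.I
  | .E => -Complex.I
  | .S => Complex.I * Complex.exp (((-θ : ℝ) : ℂ) * Complex.I)
  | .N => -Complex.I * Complex.exp (((-θ : ℝ) : ℂ) * Complex.I)

/-- `rootUnit` is a unit. [folklore] -/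
private theorem norm_rootUnit (θ : ℝ) (σ : Side) : ‖rootUnit θ σ‖ = 1 := by
  have h : ‖Complex.exp (((-θ : ℝ) : ℂ) * Complex.I)‖ = 1 := Complex.norm_exp_ofReal_mul_I _
  cases σ <;> simp only [rootUnit, norm_mul, norm_neg, Complex.norm_I, h, mul_one]

/-- ★ **Lemma E for both orientations of every class**: for every root side `σ`, every ordered class
`(z₁, z₂)` of the other sides and the remaining side `z₃`, and every `θ ∈ [π/3, 2π/3]`, the signed direction
`ε(σ; z₁, z₂)·backBracket(θ; σ, z₁, z₂, z₃)` rotated by `rootUnit θ σ` has real part `≥ v(θ)·cos(π/8)`.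
[cite: GlazmanManolescu2019, Lemma 2.1 (statement) and eq. (1) (the weights)] [cite: Glazman2015WeightedSAW, Lemma 3.1 (proof, p. 6)] -/
theorem re_rootUnit_mul_chordSign_mul_backBracket_ge {θ : ℝ} (hθ : θ ∈ Set.Icc (π / 3) (2 * π / 3))
    {σ z₁ z₂ z₃ : Side} (h01 : σ ≠ z₁) (h02 : σ ≠ z₂) (h03 : σ ≠ z₃) (h12 : z₁ ≠ z₂) (h13 : z₁ ≠ z₃)
    (h23 : z₂ ≠ z₃) :
    weightV θ * Real.cos (π / 8) ≤
      (rootUnit θ σ * ((chordSign σ z₁ z₂ : ℤ) : ℂ) * backBracket θ σ z₁ z₂ z₃).re := by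
  have hW := backBracket_cone_W hθ
  have hE := backBracket_cone_E hθ
  have hS := backBracket_cone_S hθ
  have hN := backBracket_cone_N hθ
  revert h01 h02 h03 h12 h13 h23
  cases σ <;> cases z₁ <;> cases z₂ <;> cases z₃ <;> intro h01 h02 h03 h12 h13 h23 <;>
    (try exact absurd rfl h01) <;> (try exact absurd rfl h02) <;> (try exact absurd rfl h03) <;>
    (try exact absurd rfl h12) <;> (try exact absurd rfl h13) <;> (try exact absurd rfl h23)
  case W.E.S.N =>
    rw [show chordSign .W .E .S = 1 by decide]; convert hW.2.2 using 2; simp only [rootUnit]; push_cast; ring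
  case W.E.N.S =>
    rw [show chordSign .W .E .N = -1 by decide]; convert hW.2.1 using 2; simp only [rootUnit]; push_cast; ring
  case W.S.E.N =>
    rw [show chordSign .W .S .E = -1 by decide, backBracket_swap θ (z₀ := .W) (z₁ := .E) (z₂ := .S) (z₃ := .N)
      (by decide) (by decide) (by decide) (by decide) (by decide) (by decide)]
    convert hW.2.2 using 2; simp only [rootUnit]; push_cast; ring
  case W.S.N.E =>
    rw [show chordSign .W .S .N = -1 by decide]; convert hW.1 using 2; simp only [rootUnit]; push_cast; ring
  case W.N.E.S =>
    rw [show chordSign .W .N .E = 1 by decide, backBracket_swap θ (z₀ := .W) (z₁ := .E) (z₂ := .N) (z₃ := .S)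
      (by decide) (by decide) (by decide) (by decide) (by decide) (by decide)]
    convert hW.2.1 using 2; simp only [rootUnit]; push_cast; ring
  case W.N.S.E =>
    rw [show chordSign .W .N .S = 1 by decide, backBracket_swap θ (z₀ := .W) (z₁ := .S) (z₂ := .N) (z₃ := .E)
      (by decide) (by decide) (by decide) (by decide) (by decide) (by decide)]
    convert hW.1 using 2; simp only [rootUnit]; push_cast; ring
  case E.W.S.N =>
    rw [show chordSign .E .W .S = -1 by decide, backBracket_swap θ (z₀ := .E) (z₁ := .S) (z₂ := .W) (z₃ := .N)
      (by decide) (by decide) (by decide) (by decide) (by decide) (by decide)]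
    convert hE.1 using 2; simp only [rootUnit]; push_cast; ring
  case E.W.N.S =>
    rw [show chordSign .E .W .N = 1 by decide, backBracket_swap θ (z₀ := .E) (z₁ := .N) (z₂ := .W) (z₃ := .S)
      (by decide) (by decide) (by decide) (by decide) (by decide) (by decide)]
    convert hE.2.1 using 2; simp only [rootUnit]; push_cast; ring
  case E.S.W.N =>
    rw [show chordSign .E .S .W = 1 by decide]; convert hE.1 using 2; simp only [rootUnit]; push_cast; ring
  case E.S.N.W =>
    rw [show chordSign .E .S .N = 1 by decide, backBracket_swap θ (z₀ := .E) (z₁ := .N) (z₂ := .S) (z₃ := .W)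
      (by decide) (by decide) (by decide) (by decide) (by decide) (by decide)]
    convert hE.2.2 using 2; simp only [rootUnit]; push_cast; ring
  case E.N.W.S =>
    rw [show chordSign .E .N .W = -1 by decide]; convert hE.2.1 using 2; simp only [rootUnit]; push_cast; ring
  case E.N.S.W =>
    rw [show chordSign .E .N .S = -1 by decide]; convert hE.2.2 using 2; simp only [rootUnit]; push_cast; ring
  case S.W.E.N =>
    rw [show chordSign .S .W .E = 1 by decide]; convert hS.2.2 using 2; simp only [rootUnit]; push_cast; ring
  case S.W.N.E =>
    rw [show chordSign .S .W .N = 1 by decide]; convert hS.1 using 2; simp only [rootUnit]; push_cast; ring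
  case S.E.W.N =>
    rw [show chordSign .S .E .W = -1 by decide, backBracket_swap θ (z₀ := .S) (z₁ := .W) (z₂ := .E) (z₃ := .N)
      (by decide) (by decide) (by decide) (by decide) (by decide) (by decide)]
    convert hS.2.2 using 2; simp only [rootUnit]; push_cast; ring
  case S.E.N.W =>
    rw [show chordSign .S .E .N = -1 by decide]; convert hS.2.1 using 2; simp only [rootUnit]; push_cast; ring
  case S.N.W.E =>
    rw [show chordSign .S .N .W = -1 by decide, backBracket_swap θ (z₀ := .S) (z₁ := .W) (z₂ := .N) (z₃ := .E)
      (by decide) (by decide) (by decide) (by decide) (by decide) (by decide)]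
    convert hS.1 using 2; simp only [rootUnit]; push_cast; ring
  case S.N.E.W =>
    rw [show chordSign .S .N .E = 1 by decide, backBracket_swap θ (z₀ := .S) (z₁ := .E) (z₂ := .N) (z₃ := .W)
      (by decide) (by decide) (by decide) (by decide) (by decide) (by decide)]
    convert hS.2.1 using 2; simp only [rootUnit]; push_cast; ring
  case N.W.E.S =>
    rw [show chordSign .N .W .E = -1 by decide, backBracket_swap θ (z₀ := .N) (z₁ := .E) (z₂ := .W) (z₃ := .S)
      (by decide) (by decide) (by decide) (by decide) (by decide) (by decide)]
    convert hN.2.2 using 2; simp only [rootUnit]; push_cast; ring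
  case N.W.S.E =>
    rw [show chordSign .N .W .S = -1 by decide]; convert hN.1 using 2; simp only [rootUnit]; push_cast; ring
  case N.E.W.S =>
    rw [show chordSign .N .E .W = 1 by decide]; convert hN.2.2 using 2; simp only [rootUnit]; push_cast; ring
  case N.E.S.W =>
    rw [show chordSign .N .E .S = 1 by decide]; convert hN.2.1 using 2; simp only [rootUnit]; push_cast; ring
  case N.S.W.E =>
    rw [show chordSign .N .S .W = 1 by decide, backBracket_swap θ (z₀ := .N) (z₁ := .W) (z₂ := .S) (z₃ := .E)
      (by decide) (by decide) (by decide) (by decide) (by decide) (by decide)]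
    convert hN.1 using 2; simp only [rootUnit]; push_cast; ring
  case N.S.E.W =>
    rw [show chordSign .N .S .E = -1 by decide, backBracket_swap θ (z₀ := .N) (z₁ := .E) (z₂ := .S) (z₃ := .W)
      (by decide) (by decide) (by decide) (by decide) (by decide) (by decide)]
    convert hN.2.1 using 2; simp only [rootUnit]; push_cast; ring

/-- ★ **Every backward half-bracket has modulus `v(θ)`** (the straight-arc weight), for all 24 ordered classes, on
`θ ∈ [π/3, 2π/3]` (the 12 closed forms of Part 6b/6c and `backBracket_swap`). [cite: GlazmanManolescu2019, Lemma 2.1 (statement) and eq. (1) (the weights)] [cite: Glazman2015WeightedSAW, Lemma 3.1 (proof, p. 6)] -/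
theorem norm_backBracket {θ : ℝ} (hθ : θ ∈ Set.Icc (π / 3) (2 * π / 3)) {σ z₁ z₂ z₃ : Side} (h01 : σ ≠ z₁)
    (h02 : σ ≠ z₂) (h03 : σ ≠ z₃) (h12 : z₁ ≠ z₂) (h13 : z₁ ≠ z₃) (h23 : z₂ ≠ z₃) :
    ‖backBracket θ σ z₁ z₂ z₃‖ = weightV θ := by
  have hv := weightV_nonneg hθ
  have habs : ‖(weightV θ : ℂ)‖ = weightV θ := by rw [Complex.norm_real, Real.norm_eq_abs, abs_of_nonneg hv]
  have hE : ∀ x : ℝ, ‖Complex.exp ((x : ℂ) * Complex.I)‖ = 1 := fun x => Complex.norm_exp_ofReal_mul_I x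
  revert h01 h02 h03 h12 h13 h23
  cases σ <;> cases z₁ <;> cases z₂ <;> cases z₃ <;> intro h01 h02 h03 h12 h13 h23 <;>
    (try exact absurd rfl h01) <;> (try exact absurd rfl h02) <;> (try exact absurd rfl h03) <;>
    (try exact absurd rfl h12) <;> (try exact absurd rfl h13) <;> (try exact absurd rfl h23)
  case W.E.S.N =>
    rw [backBracket_W_E_S_N]
    simp only [norm_mul, norm_neg, Complex.norm_I, habs, hE, one_mul, mul_one]
  case W.E.N.S =>
    rw [backBracket_W_E_N_S]
    simp only [norm_mul, Complex.norm_I, habs, hE, one_mul, mul_one]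
  case W.S.E.N =>
    rw [backBracket_swap θ (z₀ := .W) (z₁ := .E) (z₂ := .S) (z₃ := .N) (by decide) (by decide) (by decide)
      (by decide) (by decide) (by decide), norm_neg, backBracket_W_E_S_N]
    simp only [norm_mul, norm_neg, Complex.norm_I, habs, hE, one_mul, mul_one]
  case W.S.N.E =>
    rw [backBracket_W_S_N_E]
    simp only [norm_mul, Complex.norm_I, habs, one_mul]
  case W.N.E.S =>
    rw [backBracket_swap θ (z₀ := .W) (z₁ := .E) (z₂ := .N) (z₃ := .S) (by decide) (by decide) (by decide)
      (by decide) (by decide) (by decide), norm_neg, backBracket_W_E_N_S]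
    simp only [norm_mul, Complex.norm_I, habs, hE, one_mul, mul_one]
  case W.N.S.E =>
    rw [backBracket_swap θ (z₀ := .W) (z₁ := .S) (z₂ := .N) (z₃ := .E) (by decide) (by decide) (by decide)
      (by decide) (by decide) (by decide), norm_neg, backBracket_W_S_N_E]
    simp only [norm_mul, Complex.norm_I, habs, one_mul]
  case E.W.S.N =>
    rw [backBracket_swap θ (z₀ := .E) (z₁ := .S) (z₂ := .W) (z₃ := .N) (by decide) (by decide) (by decide)
      (by decide) (by decide) (by decide), norm_neg, backBracket_E_S_W_N]
    simp only [norm_mul, norm_neg, habs, hE, mul_one]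
  case E.W.N.S =>
    rw [backBracket_swap θ (z₀ := .E) (z₁ := .N) (z₂ := .W) (z₃ := .S) (by decide) (by decide) (by decide)
      (by decide) (by decide) (by decide), norm_neg, backBracket_E_N_W_S]
    simp only [norm_mul, habs, hE, mul_one]
  case E.S.W.N =>
    rw [backBracket_E_S_W_N]
    simp only [norm_mul, norm_neg, habs, hE, mul_one]
  case E.S.N.W =>
    rw [backBracket_swap θ (z₀ := .E) (z₁ := .N) (z₂ := .S) (z₃ := .W) (by decide) (by decide) (by decide)
      (by decide) (by decide) (by decide), norm_neg, backBracket_E_N_S_W]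
    simp only [norm_neg, norm_mul, Complex.norm_I, habs, one_mul]
  case E.N.W.S =>
    rw [backBracket_E_N_W_S]
    simp only [norm_mul, habs, hE, mul_one]
  case E.N.S.W =>
    rw [backBracket_E_N_S_W]
    simp only [norm_neg, norm_mul, Complex.norm_I, habs, one_mul]
  case S.W.E.N =>
    rw [backBracket_S_W_E_N]
    simp only [norm_mul, norm_neg, Complex.norm_I, habs, hE, one_mul, mul_one]
  case S.W.N.E =>
    rw [backBracket_S_W_N_E]
    simp only [norm_mul, norm_neg, habs, hE, mul_one]
  case S.E.W.N =>
    rw [backBracket_swap θ (z₀ := .S) (z₁ := .W) (z₂ := .E) (z₃ := .N) (by decide) (by decide) (by decide)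
      (by decide) (by decide) (by decide), norm_neg, backBracket_S_W_E_N]
    simp only [norm_mul, norm_neg, Complex.norm_I, habs, hE, one_mul, mul_one]
  case S.E.N.W =>
    rw [backBracket_S_E_N_W]
    simp only [norm_mul, habs, hE, mul_one]
  case S.N.W.E =>
    rw [backBracket_swap θ (z₀ := .S) (z₁ := .W) (z₂ := .N) (z₃ := .E) (by decide) (by decide) (by decide)
      (by decide) (by decide) (by decide), norm_neg, backBracket_S_W_N_E]
    simp only [norm_mul, norm_neg, habs, hE, mul_one]
  case S.N.E.W =>
    rw [backBracket_swap θ (z₀ := .S) (z₁ := .E) (z₂ := .N) (z₃ := .W) (by decide) (by decide) (by decide)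
      (by decide) (by decide) (by decide), norm_neg, backBracket_S_E_N_W]
    simp only [norm_mul, habs, hE, mul_one]
  case N.W.E.S =>
    rw [backBracket_swap θ (z₀ := .N) (z₁ := .E) (z₂ := .W) (z₃ := .S) (by decide) (by decide) (by decide)
      (by decide) (by decide) (by decide), norm_neg, backBracket_N_E_W_S]
    simp only [norm_mul, Complex.norm_I, habs, hE, one_mul, mul_one]
  case N.W.S.E =>
    rw [backBracket_N_W_S_E]
    simp only [norm_mul, norm_neg, habs, hE, mul_one]
  case N.E.W.S =>
    rw [backBracket_N_E_W_S]
    simp only [norm_mul, Complex.norm_I, habs, hE, one_mul, mul_one]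
  case N.E.S.W =>
    rw [backBracket_N_E_S_W]
    simp only [norm_mul, habs, hE, mul_one]
  case N.S.W.E =>
    rw [backBracket_swap θ (z₀ := .N) (z₁ := .W) (z₂ := .S) (z₃ := .E) (by decide) (by decide) (by decide)
      (by decide) (by decide) (by decide), norm_neg, backBracket_N_W_S_E]
    simp only [norm_mul, norm_neg, habs, hE, mul_one]
  case N.S.E.W =>
    rw [backBracket_swap θ (z₀ := .N) (z₁ := .E) (z₂ := .S) (z₃ := .W) (by decide) (by decide) (by decide)
      (by decide) (by decide) (by decide), norm_neg, backBracket_N_E_S_W]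
    simp only [norm_mul, habs, hE, mul_one]

namespace ΩG

variable {D : Set Face} {w : Face} {σ : Side}

/-- `sin (5π ε / 2) = ε` for `ε = ±1`. [folklore] -/
private theorem sin_five_eighths_four_pi_chordSign (σ z₁ z₂ : Side) :
    Real.sin (5 / 8 * (4 * π * chordSign σ z₁ z₂)) = chordSign σ z₁ z₂ := by
  rcases chordSign_eq_or σ z₁ z₂ with e | e <;> rw [e] <;> push_cast
  · rw [show (5 : ℝ) / 8 * (4 * π * 1) = π / 2 + 2 * π by ring, Real.sin_add_two_pi, Real.sin_pi_div_two]
  · rw [show (5 : ℝ) / 8 * (4 * π * -1) = -(π / 2 + 2 * π) by ring, Real.sin_neg, Real.sin_add_two_pi,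
      Real.sin_pi_div_two]

/-- ★★ **The sign law at the root's own plaquette.** For a walk of class `B2a` at the root plaquette `w`
(root `w.side σ`, exit side `z₁`, return side `z₂`), EITHER `WE = excursionWinding(θ; σ, z₁, z₂)` (the
excursion is unwound; the group sign is `0`) OR `WE - excursionWinding = 4π·ε(σ; z₁, z₂)` and the group sign
`sin((5/8)(WE - excursionWinding))` equals the chord sign `ε(σ; z₁, z₂)`. (Winding law of the parent file +
the sign rule `AJ_midPt_side_eq`, in either orientation.) [cite: GlazmanManolescu2019, Lemma 2.1 (statement, "in the form given in [Gl]")] [cite: Glazman2015WeightedSAW, Lemma 3.1 (proof, p. 6: the classes of walks through a rhombus)]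
[cite: DuminilCopinSmirnov2012, proof of Lemma 1] -/
theorem sign_law_root (ω : ΩG D (w.side σ) w) (hr : RootedFace D (w.side σ) w) (h : ω.IsB2a) (θ : ℝ) :
    (ω.WE (fun _ => θ) = excursionWinding θ σ (ω.z1 hr h) ω.1 ∧
        Real.sin (5 / 8 * (ω.WE (fun _ => θ) - excursionWinding θ σ (ω.z1 hr h) ω.1)) = 0) ∨
      (ω.WE (fun _ => θ) - excursionWinding θ σ (ω.z1 hr h) ω.1 = 4 * π * chordSign σ (ω.z1 hr h) ω.1 ∧
        Real.sin (5 / 8 * (ω.WE (fun _ => θ) - excursionWinding θ σ (ω.z1 hr h) ω.1)) =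
          chordSign σ (ω.z1 hr h) ω.1) := by
  have hd := ω.2.sides_distinctG hr h.1
  rw [ω.returnSide_of_isB2a h, ω.firstSideG_root] at hd
  -- hd : z1 ≠ σ ∧ ω.1 ≠ σ ∧ ω.1 ≠ z1
  have hσ1 : σ ≠ ω.z1 hr h := fun e => hd.1 e.symm
  have hσ2 : σ ≠ ω.1 := fun e => hd.2.1 e.symm
  have h12 : ω.z1 hr h ≠ ω.1 := fun e => hd.2.2 e.symm
  rcases canon_or_swap hσ1 hσ2 h12 with hc | hc
  · have hc' : Canon ω.2.firstSideG (ω.z1 hr h) ω.1 := by rw [ω.firstSideG_root]; exact hc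
    have e := ω.WE_eq_excursionWinding_add_two_AJ hr hc' (fun _ => θ)
    rw [ω.firstSideG_root] at e
    change ω.WE (fun _ => θ) = excursionWinding θ σ (ω.z1 hr h) ω.1 + 2 * ω.AJ hr h (toC (midPt (w.side σ))) at e
    rcases AJ_midPt_side_eq (hr := hr) h hσ1 hσ2 with hA | hA
    · left
      have hWE : ω.WE (fun _ => θ) = excursionWinding θ σ (ω.z1 hr h) ω.1 := by rw [e, hA]; ring
      exact ⟨hWE, by rw [hWE, sub_self, mul_zero, Real.sin_zero]⟩
    · right
      have hWE : ω.WE (fun _ => θ) - excursionWinding θ σ (ω.z1 hr h) ω.1 = 4 * π * chordSign σ (ω.z1 hr h) ω.1 := by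
        rw [e, hA]; ring
      exact ⟨hWE, by rw [hWE, sin_five_eighths_four_pi_chordSign]⟩
  · have h'' := ω.rev_isB2a hr h
    have hz1 : (ω.rev hr).z1 hr h'' = ω.1 := by unfold ΩG.z1; exact ω.rev_exitSide hr h
    have hfst : (ω.rev hr).1 = ω.z1 hr h := ω.rev_fst hr h
    have hc' : Canon (ω.rev hr).2.firstSideG ((ω.rev hr).z1 hr h'') (ω.rev hr).1 := by
      rw [ω.rev_firstSide hr h, ω.firstSideG_root, hz1, hfst]; exact hc
    have e := ω.WE_eq_excursionWinding_sub_two_AJ_rev hr (h := h) hc' (fun _ => θ)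
    rw [ω.firstSideG_root] at e
    change ω.WE (fun _ => θ) = excursionWinding θ σ (ω.z1 hr h) ω.1 -
      2 * (ω.rev hr).AJ hr h'' (toC (midPt (w.side σ))) at e
    rcases AJ_midPt_side_eq (ω := ω.rev hr) (hr := hr) h'' (by rw [hz1]; exact hσ2) (by rw [hfst]; exact hσ1)
      with hA | hA
    · left
      have hWE : ω.WE (fun _ => θ) = excursionWinding θ σ (ω.z1 hr h) ω.1 := by rw [e, hA]; ring
      exact ⟨hWE, by rw [hWE, sub_self, mul_zero, Real.sin_zero]⟩
    · right
      rw [hz1, hfst, chordSign_swap σ _ _ hσ1 hσ2 h12] at hA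
      have hWE : ω.WE (fun _ => θ) - excursionWinding θ σ (ω.z1 hr h) ω.1 = 4 * π * chordSign σ (ω.z1 hr h) ω.1 := by
        rw [e, hA]; push_cast; ring
      exact ⟨hWE, by rw [hWE, sin_five_eighths_four_pi_chordSign]⟩

open Classical in
/-- **The wound mass of a walk at the root's own plaquette**: its exterior weight if it is of class `B2a` and
WOUND (`WE ≠ excursionWinding(θ; σ, exit, return)`), else `0`. [cite: GlazmanManolescu2019, Lemma 2.1 (statement, "in the form given in [Gl]")] [cite: Glazman2015WeightedSAW, Lemma 3.1 (proof, p. 6: the classes of walks through a rhombus)] -/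
noncomputable def woundMass (θ : ℝ) (hr : RootedFace D (w.side σ) w) (ω : ΩG D (w.side σ) w) : ℝ :=
  if h : ω.IsB2a then
    (if ω.WE (fun _ => θ) = excursionWinding θ σ (ω.z1 hr h) ω.1 then 0 else ω.2.extWeight (fun _ => θ) w)
  else 0

/-- Exterior weights are non-negative on `[π/3, 2π/3]`. [cite: GlazmanManolescu2019, eq. (1) (the weights are non-negative)] -/
theorem extWeight_nonneg {θ : ℝ} (hθ : θ ∈ Set.Icc (π / 3) (2 * π / 3)) {a z : MidEdge} (γ : YBWalk D a z)
    (r : Face) : 0 ≤ γ.extWeight (fun _ => θ) r :=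
  Finset.prod_nonneg fun _ _ => localWeight_nonneg hθ _

/-- The wound mass is non-negative. [cite: GlazmanManolescu2019, Lemma 2.1 (statement, "in the form given in [Gl]")] [cite: Glazman2015WeightedSAW, Lemma 3.1 (proof, p. 6: the classes of walks through a rhombus)] -/
theorem woundMass_nonneg {θ : ℝ} (hθ : θ ∈ Set.Icc (π / 3) (2 * π / 3)) (hr : RootedFace D (w.side σ) w)
    (ω : ΩG D (w.side σ) w) : 0 ≤ woundMass θ hr ω := by
  unfold woundMass
  split_ifs
  · exact le_rfl
  · exact extWeight_nonneg hθ _ _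
  · exact le_rfl

/-- `woundMass = 0` means: not of class `B2a`, or unwound, or of exterior weight `0`.
[cite: GlazmanManolescu2019, Lemma 2.1 (statement, "in the form given in [Gl]")] [cite: Glazman2015WeightedSAW, Lemma 3.1 (proof, p. 6: the classes of walks through a rhombus)] -/
theorem woundMass_eq_zero_iff {θ : ℝ} (hr : RootedFace D (w.side σ) w) (ω : ΩG D (w.side σ) w) :
    woundMass θ hr ω = 0 ↔ ∀ h : ω.IsB2a,
      ω.WE (fun _ => θ) = excursionWinding θ σ (ω.z1 hr h) ω.1 ∨ ω.2.extWeight (fun _ => θ) w = 0 := by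
  unfold woundMass
  by_cases h : ω.IsB2a
  · simp only [dif_pos h]
    constructor
    · intro h0 _
      by_cases hW : ω.WE (fun _ => θ) = excursionWinding θ σ (ω.z1 hr h) ω.1
      · exact Or.inl hW
      · rw [if_neg hW] at h0; exact Or.inr h0
    · intro H
      rcases H h with hW | h0
      · rw [if_pos hW]
      · split_ifs <;> first | rfl | exact h0
  · rw [dif_neg h]
    exact iff_of_true rfl fun h' => absurd h' h

/-- ★ **Per-walk bound**: at the root's own plaquette the signed class term of a class-`B2a` walk, rotated by
`rootUnit`, has real part at least `v(θ)·cos(π/8)` times its wound mass.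
[cite: GlazmanManolescu2019, Lemma 2.1 (statement, "in the form given in [Gl]")] [cite: Glazman2015WeightedSAW, Lemma 3.1 (proof, p. 6: the classes of walks through a rhombus)] -/
theorem re_rootUnit_mul_classTerm_ge {θ : ℝ} (hθ : θ ∈ Set.Icc (π / 3) (2 * π / 3)) (ω : ΩG D (w.side σ) w)
    (hr : RootedFace D (w.side σ) w) (h : ω.IsB2a) :
    weightV θ * Real.cos (π / 8) * woundMass θ hr ω ≤ (rootUnit θ σ * ω.classTerm (fun _ => θ) hr).re := by
  have hd := ω.2.sides_distinctG hr h.1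
  rw [ω.returnSide_of_isB2a h, ω.firstSideG_root] at hd
  have h3 := ω.z₃_spec hr h
  rw [ω.firstSideG_root] at h3
  rw [ω.classTerm_root (fun _ => θ) hr h]
  change weightV θ * Real.cos (π / 8) * woundMass θ hr ω ≤
    (rootUnit θ σ * ((ω.2.extWeight (fun _ => θ) w : ℂ) *
      (Real.sin (5 / 8 * (ω.WE (fun _ => θ) - excursionWinding θ σ (ω.z1 hr h) ω.1)) : ℂ) *
        backBracket θ σ (ω.z1 hr h) ω.1 (ω.z₃ hr h))).re
  unfold woundMass
  rw [dif_pos h]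
  rcases sign_law_root ω hr h θ with ⟨hWE, hs⟩ | ⟨hWE, hs⟩
  · rw [if_pos hWE, hs]; simp
  · have hne : ω.WE (fun _ => θ) ≠ excursionWinding θ σ (ω.z1 hr h) ω.1 := by
      intro e; rw [e, sub_self] at hWE
      rcases chordSign_eq_or σ (ω.z1 hr h) ω.1 with e' | e' <;> rw [e'] at hWE <;> push_cast at hWE <;>
        nlinarith [Real.pi_pos]
    rw [if_neg hne, hs]
    have key := re_rootUnit_mul_chordSign_mul_backBracket_ge hθ (σ := σ) (z₁ := ω.z1 hr h) (z₂ := ω.1)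
      (z₃ := ω.z₃ hr h) (fun e => hd.1 e.symm) (fun e => hd.2.1 e.symm) (fun e => h3.1 e.symm)
      (fun e => hd.2.2 e.symm) (fun e => h3.2.1 e.symm) (fun e => h3.2.2 e.symm)
    have hext := extWeight_nonneg hθ ω.2 w
    have e : rootUnit θ σ * ((ω.2.extWeight (fun _ => θ) w : ℂ) * ((chordSign σ (ω.z1 hr h) ω.1 : ℝ) : ℂ) *
        backBracket θ σ (ω.z1 hr h) ω.1 (ω.z₃ hr h)) =
        (ω.2.extWeight (fun _ => θ) w : ℂ) *
          (rootUnit θ σ * ((chordSign σ (ω.z1 hr h) ω.1 : ℤ) : ℂ) * backBracket θ σ (ω.z1 hr h) ω.1 (ω.z₃ hr h)) := by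
      push_cast; ring
    rw [e, Complex.re_ofReal_mul]
    exact mul_comm (weightV θ * Real.cos (π / 8)) _ ▸ mul_le_mul_of_nonneg_left key hext

/-- A walk of wound mass `0` has class term `0`. [cite: GlazmanManolescu2019, Lemma 2.1 (statement, "in the form given in [Gl]")] [cite: Glazman2015WeightedSAW, Lemma 3.1 (proof, p. 6: the classes of walks through a rhombus)] -/
theorem classTerm_eq_zero_of_woundMass_eq_zero {θ : ℝ} (ω : ΩG D (w.side σ) w) (hr : RootedFace D (w.side σ) w)
    (h : ω.IsB2a) (h0 : woundMass θ hr ω = 0) : ω.classTerm (fun _ => θ) hr = 0 := by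
  rw [ω.classTerm_root (fun _ => θ) hr h]
  change (ω.2.extWeight (fun _ => θ) w : ℂ) *
      (Real.sin (5 / 8 * (ω.WE (fun _ => θ) - excursionWinding θ σ (ω.z1 hr h) ω.1)) : ℂ) *
        backBracket θ σ (ω.z1 hr h) ω.1 (ω.z₃ hr h) = 0
  rcases (woundMass_eq_zero_iff hr ω).1 h0 h with hW | he
  · rw [hW, sub_self, mul_zero, Real.sin_zero]; simp
  · rw [he]; simp

/-- **Per-walk upper bound**: the class term of a class-`B2a` walk at the root's own plaquette has modulus at most
`v(θ)` times its wound mass. [cite: GlazmanManolescu2019, Lemma 2.1 (statement, "in the form given in [Gl]")] [cite: Glazman2015WeightedSAW, Lemma 3.1 (proof, p. 6: the classes of walks through a rhombus)] -/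
theorem norm_classTerm_le {θ : ℝ} (hθ : θ ∈ Set.Icc (π / 3) (2 * π / 3)) (ω : ΩG D (w.side σ) w)
    (hr : RootedFace D (w.side σ) w) (h : ω.IsB2a) :
    ‖ω.classTerm (fun _ => θ) hr‖ ≤ weightV θ * woundMass θ hr ω := by
  have hd := ω.2.sides_distinctG hr h.1
  rw [ω.returnSide_of_isB2a h, ω.firstSideG_root] at hd
  have h3 := ω.z₃_spec hr h
  rw [ω.firstSideG_root] at h3
  rw [ω.classTerm_root (fun _ => θ) hr h]
  change ‖(ω.2.extWeight (fun _ => θ) w : ℂ) *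
      (Real.sin (5 / 8 * (ω.WE (fun _ => θ) - excursionWinding θ σ (ω.z1 hr h) ω.1)) : ℂ) *
        backBracket θ σ (ω.z1 hr h) ω.1 (ω.z₃ hr h)‖ ≤ weightV θ * woundMass θ hr ω
  unfold woundMass
  rw [dif_pos h]
  rcases sign_law_root ω hr h θ with ⟨hWE, hs⟩ | ⟨hWE, hs⟩
  · rw [if_pos hWE, hs]; simp
  · have hne : ω.WE (fun _ => θ) ≠ excursionWinding θ σ (ω.z1 hr h) ω.1 := by
      intro e; rw [e, sub_self] at hWE
      rcases chordSign_eq_or σ (ω.z1 hr h) ω.1 with e' | e' <;> rw [e'] at hWE <;> push_cast at hWE <;>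
        nlinarith [Real.pi_pos]
    rw [if_neg hne, hs, norm_mul, norm_mul,
      norm_backBracket hθ (σ := σ) (z₁ := ω.z1 hr h) (z₂ := ω.1) (z₃ := ω.z₃ hr h) (fun e => hd.1 e.symm)
        (fun e => hd.2.1 e.symm) (fun e => h3.1 e.symm) (fun e => hd.2.2 e.symm) (fun e => h3.2.1 e.symm)
        (fun e => h3.2.2 e.symm),
      Complex.norm_real, Real.norm_eq_abs, abs_of_nonneg (extWeight_nonneg hθ ω.2 w)]
    have hsgn : ‖((chordSign σ (ω.z1 hr h) ω.1 : ℝ) : ℂ)‖ = 1 := by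
      rcases chordSign_eq_or σ (ω.z1 hr h) ω.1 with e' | e' <;> rw [e'] <;> simp
    rw [hsgn, mul_one, mul_comm]

end ΩG

end Literature.Probability.RandomPlanarGeometry.SAW.YangBaxter

namespace Literature.Barriers.CriticalPhenomena.PlaquetteWalk

open Literature.Probability.RandomPlanarGeometry.SAW.YangBaxter
open Real Complex

/-- The vertex functional at the root's own plaquette is the root phase times `i` times the sum of the signed
class terms. [cite: GlazmanManolescu2019, Lemma 2.1 (statement, "in the form given in [Gl]")] [cite: Glazman2015WeightedSAW, Lemma 3.1 (proof, p. 6: the classes of walks through a rhombus)] -/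
private theorem vertexFunctional_printed_root_eq_sum_classTerm {θ : ℝ} (hθ : θ ∈ Set.Icc (π / 3) (2 * π / 3))
    (Dl : List Face) (w : Face) (σ : Side) (hr : RootedFace (dom Dl) (w.side σ) w) :
    vertexFunctional (printedWeights θ) tFiveEighths (ybCoeff θ) Dl (w.side σ) w =
      Complex.exp (((-(5 / 8 * slantPot (fun _ => θ) (w.side σ)) : ℝ) : ℂ) * Complex.I) *
        (Complex.I * ∑ ω ∈ ΩG.setB2a (dom Dl) (w.side σ) w, ω.classTerm (fun _ => θ) hr) := by
  rw [vertexFunctional_printed_eq_phase_mul_lem21Defect, ← ΩG.sum_g_eq_lem21Defect,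
    ΩG.sum_g_eq_I_mul_sum_classTerm (fun _ => θ) hr (fun _ => hθ)]

/-- ★★★ **THE ROOT-PLAQUETTE DEFECT LAW (thick walls included).** For every `θ ∈ [π/3, 2π/3]`, every finite
face list, every plaquette `w` and side `σ` with the root `w.side σ` non-interior:
`‖VF_D(w.side σ, w)‖ ≥ v(θ)·cos(π/8)·Σ_{ω ∈ B2a(w)} woundMass(ω)`, the total exterior weight of the WOUND
class-`B2a` walks at `w` (those whose excursion winds around the root: `WE ≠ excursionWinding`). In words: at a
hole root the Yang–Baxter vertex identity fails at the root's own plaquette by at least a fixed positive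
multiple of the mass of wound excursions — no cancellation between winding classes is possible (sign rule +
Lemma E). [cite: GlazmanManolescu2019, Lemma 2.1 (statement, "in the form given in [Gl]")] [cite: Glazman2015WeightedSAW, Lemma 3.1 (proof, p. 6: the classes of walks through a rhombus)] [cite: DuminilCopinSmirnov2012, proof of Lemma 1] -/
theorem vertexFunctional_printed_root_plaquette_defect_law {θ : ℝ} (hθ : θ ∈ Set.Icc (π / 3) (2 * π / 3))
    (Dl : List Face) (w : Face) (σ : Side) (hr : RootedFace (dom Dl) (w.side σ) w) :
    weightV θ * Real.cos (π / 8) * ∑ ω ∈ ΩG.setB2a (dom Dl) (w.side σ) w, ΩG.woundMass θ hr ω ≤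
      ‖vertexFunctional (printedWeights θ) tFiveEighths (ybCoeff θ) Dl (w.side σ) w‖ := by
  set Φ := ∑ ω ∈ ΩG.setB2a (dom Dl) (w.side σ) w, ω.classTerm (fun _ => θ) hr with hΦ
  have hVF := vertexFunctional_printed_root_eq_sum_classTerm hθ Dl w σ hr
  rw [hVF, norm_mul, norm_mul, Complex.norm_exp_ofReal_mul_I, Complex.norm_I, one_mul, one_mul]
  calc weightV θ * Real.cos (π / 8) * ∑ ω ∈ ΩG.setB2a (dom Dl) (w.side σ) w, ΩG.woundMass θ hr ω
      = ∑ ω ∈ ΩG.setB2a (dom Dl) (w.side σ) w, weightV θ * Real.cos (π / 8) * ΩG.woundMass θ hr ω := by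
        rw [Finset.mul_sum]
    _ ≤ ∑ ω ∈ ΩG.setB2a (dom Dl) (w.side σ) w, (rootUnit θ σ * ω.classTerm (fun _ => θ) hr).re := by
        refine Finset.sum_le_sum fun ω hω => ?_
        simp only [ΩG.setB2a, Finset.mem_filter, Finset.mem_univ, true_and] at hω
        have h : ω.IsB2a := hω
        exact ΩG.re_rootUnit_mul_classTerm_ge hθ ω hr h
    _ = (rootUnit θ σ * Φ).re := by rw [hΦ, Finset.mul_sum, Complex.re_sum]
    _ ≤ ‖rootUnit θ σ * Φ‖ := Complex.re_le_norm _
    _ = ‖Φ‖ := by rw [norm_mul, norm_rootUnit, one_mul]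

/-- ★ **Upper bound**: `‖VF_D(w.side σ, w)‖ ≤ v(θ)·Σ_{ω ∈ B2a(w)} woundMass ω` — together with the defect law the
modulus of the vertex functional at the root's own plaquette is pinned between `v cos(π/8)` and `v` times the wound
mass. [cite: GlazmanManolescu2019, Lemma 2.1 (statement, "in the form given in [Gl]")] [cite: Glazman2015WeightedSAW, Lemma 3.1 (proof, p. 6: the classes of walks through a rhombus)] -/
theorem norm_vertexFunctional_printed_root_plaquette_le {θ : ℝ} (hθ : θ ∈ Set.Icc (π / 3) (2 * π / 3))
    (Dl : List Face) (w : Face) (σ : Side) (hr : RootedFace (dom Dl) (w.side σ) w) :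
    ‖vertexFunctional (printedWeights θ) tFiveEighths (ybCoeff θ) Dl (w.side σ) w‖ ≤
      weightV θ * ∑ ω ∈ ΩG.setB2a (dom Dl) (w.side σ) w, ΩG.woundMass θ hr ω := by
  rw [vertexFunctional_printed_root_eq_sum_classTerm hθ Dl w σ hr, norm_mul, norm_mul,
    Complex.norm_exp_ofReal_mul_I, Complex.norm_I, one_mul, one_mul, Finset.mul_sum]
  refine (norm_sum_le _ _).trans (Finset.sum_le_sum fun ω hω => ?_)
  simp only [ΩG.setB2a, Finset.mem_filter, Finset.mem_univ, true_and] at hω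
  have h : ω.IsB2a := hω
  exact ΩG.norm_classTerm_le hθ ω hr h

/-- ★★★ **THE WOUND-WALK DICHOTOMY at the root's own plaquette** (the lane's (Q2′)): for every
`θ ∈ [π/3, 2π/3]`, finite face list, plaquette `w` and side `σ` with `w.side σ` non-interior, the Yang–Baxter
vertex functional vanishes at `w` IF AND ONLY IF every class-`B2a` walk at `w` is unwound
(`WE = excursionWinding(θ; σ, exit, return)`) or has exterior weight `0`. For isthmus roots this is Part 4's
dichotomy; «pocket» hole roots (no class-`B2a` walk) and outer roots are on the vanishing side; thick walls with
a wound excursion of positive weight are on the non-vanishing side.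
[cite: GlazmanManolescu2019, Lemma 2.1 (statement, "in the form given in [Gl]")] [cite: Glazman2015WeightedSAW, Lemma 3.1 (proof, p. 6: the classes of walks through a rhombus)] [cite: DuminilCopinSmirnov2012, proof of Lemma 1] -/
theorem vertexFunctional_printed_root_plaquette_eq_zero_iff {θ : ℝ} (hθ : θ ∈ Set.Icc (π / 3) (2 * π / 3))
    (Dl : List Face) (w : Face) (σ : Side) (hr : RootedFace (dom Dl) (w.side σ) w) :
    vertexFunctional (printedWeights θ) tFiveEighths (ybCoeff θ) Dl (w.side σ) w = 0 ↔
      ∀ ω ∈ ΩG.setB2a (dom Dl) (w.side σ) w, ΩG.woundMass θ hr ω = 0 := by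
  constructor
  · intro h0
    have hle := vertexFunctional_printed_root_plaquette_defect_law hθ Dl w σ hr
    rw [h0, norm_zero] at hle
    have hv : 0 < weightV θ :=
      weightV_pos_of_mem_Ioo ⟨by linarith [hθ.1, Real.pi_pos], by linarith [hθ.2, Real.pi_pos]⟩
    have hc : 0 < Real.cos (π / 8) := Real.cos_pos_of_mem_Ioo ⟨by linarith [Real.pi_pos], by linarith [Real.pi_pos]⟩
    have hsum : ∑ ω ∈ ΩG.setB2a (dom Dl) (w.side σ) w, ΩG.woundMass θ hr ω ≤ 0 := by
      by_contra hpos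
      exact absurd hle (not_le.2 (mul_pos (mul_pos hv hc) (lt_of_not_ge hpos)))
    have hnn : ∀ ω ∈ ΩG.setB2a (dom Dl) (w.side σ) w, 0 ≤ ΩG.woundMass θ hr ω :=
      fun ω _ => ΩG.woundMass_nonneg hθ hr ω
    have hzero := le_antisymm hsum (Finset.sum_nonneg hnn)
    exact (Finset.sum_eq_zero_iff_of_nonneg hnn).1 hzero
  · intro H
    rw [vertexFunctional_printed_root_eq_sum_classTerm hθ Dl w σ hr]
    have : ∑ ω ∈ ΩG.setB2a (dom Dl) (w.side σ) w, ω.classTerm (fun _ => θ) hr = 0 := by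
      refine Finset.sum_eq_zero fun ω hω => ?_
      have hω' := hω
      simp only [ΩG.setB2a, Finset.mem_filter, Finset.mem_univ, true_and] at hω'
      have h : ω.IsB2a := hω'
      exact ΩG.classTerm_eq_zero_of_woundMass_eq_zero ω hr h (H ω hω)
    rw [this]; simp


/-! ### The open range `θ ∈ (π/3, 2π/3)`: all local weights are positive, so «wound mass 0» means «unwound» -/

/-- On the OPEN range every local weight of a walk is positive (the five weights of eq. (1) are positive
there; `w₂ = 0` only at `θ = π/3`, `w₁ = 0` only at `θ = 2π/3`; the kinds in a face are one of the six
shapes of Fig. 1, `kindsL_shape`). [cite: GlazmanManolescu2019, §1, eq. (1) and Fig. 1] -/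
theorem _root_.Literature.Probability.RandomPlanarGeometry.SAW.YangBaxter.YBWalk.localWeight_kindsIn_pos
    {θ : ℝ} (hθ : θ ∈ Set.Ioo (π / 3) (2 * π / 3)) {D : Set Face} {a z : MidEdge} (γ : YBWalk D a z)
    (f : Face) : 0 < localWeight θ (γ.kindsIn f) := by
  have hθ' : θ ∈ Set.Ioo 0 π := ⟨by linarith [hθ.1, Real.pi_pos], by linarith [hθ.2, Real.pi_pos]⟩
  have e : γ.kindsIn f = kindsL γ.mids f := rfl
  rw [e]
  rcases kindsL_shape γ f with h | h | h | h | h | h <;> rw [h] <;> simp only [localWeight]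
  · exact one_pos
  · exact weightU1_pos_of_mem_Ioo hθ'
  · exact weightU2_pos_of_mem_Ioo hθ'
  · exact weightV_pos_of_mem_Ioo hθ'
  · rw [weightW1_eq_weightU1_mul]
    refine mul_pos (weightU1_pos_of_mem_Ioo hθ') (sub_pos.2 ?_)
    rw [← Real.sin_pi_div_two_sub]
    exact Real.sin_lt_sin_of_lt_of_le_pi_div_two (by linarith [hθ.1, Real.pi_pos]) (by linarith [hθ.1, Real.pi_pos])
      (by linarith [hθ.2])
  · rw [weightW2_eq_sqrt_two_mul]
    refine mul_pos (mul_pos (Real.sqrt_pos.2 (by norm_num)) (weightU2_pos_of_mem_Ioo hθ')) ?_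
    exact Real.sin_pos_of_pos_of_lt_pi (by linarith [hθ.1]) (by linarith [hθ.2, Real.pi_pos])

/-- On the open range the exterior weight of every walk is positive. [cite: GlazmanManolescu2019, §1, eq. (1)] -/
theorem _root_.Literature.Probability.RandomPlanarGeometry.SAW.YangBaxter.YBWalk.extWeight_pos
    {θ : ℝ} (hθ : θ ∈ Set.Ioo (π / 3) (2 * π / 3)) {D : Set Face} {a z : MidEdge} (γ : YBWalk D a z)
    (r : Face) : 0 < γ.extWeight (fun _ => θ) r :=
  Finset.prod_pos fun g _ => γ.localWeight_kindsIn_pos hθ g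

/-- ★★★ **THE WOUND-WALK DICHOTOMY ON THE OPEN RANGE.** For every `θ ∈ (π/3, 2π/3)`, finite face list,
plaquette `w` and side `σ` with `w.side σ` non-interior: the Yang–Baxter vertex functional vanishes at the root's
own plaquette IF AND ONLY IF every class-`B2a` walk at `w` is UNWOUND (`WE = excursionWinding(θ; σ, exit,
return)`, i.e. its excursion does not wind around the root). [cite: GlazmanManolescu2019, Lemma 2.1 (statement, "in the form given in [Gl]")] [cite: Glazman2015WeightedSAW, Lemma 3.1 (proof, p. 6: the classes of walks through a rhombus)]
[cite: DuminilCopinSmirnov2012, proof of Lemma 1] -/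
theorem vertexFunctional_printed_root_plaquette_eq_zero_iff_unwound {θ : ℝ} (hθ : θ ∈ Set.Ioo (π / 3) (2 * π / 3))
    (Dl : List Face) (w : Face) (σ : Side) (hr : RootedFace (dom Dl) (w.side σ) w) :
    vertexFunctional (printedWeights θ) tFiveEighths (ybCoeff θ) Dl (w.side σ) w = 0 ↔
      ∀ ω ∈ ΩG.setB2a (dom Dl) (w.side σ) w, ∀ h : ω.IsB2a,
        ω.WE (fun _ => θ) = excursionWinding θ σ (ω.z1 hr h) ω.1 := by
  rw [vertexFunctional_printed_root_plaquette_eq_zero_iff (Set.Ioo_subset_Icc_self hθ) Dl w σ hr]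
  refine forall₂_congr fun ω _ => ?_
  rw [ΩG.woundMass_eq_zero_iff]
  refine forall_congr' fun h => ?_
  constructor
  · rintro (hW | h0)
    · exact hW
    · exact absurd h0 (ω.2.extWeight_pos hθ w).ne'
  · exact fun hW => Or.inl hW

end Literature.Barriers.CriticalPhenomena.PlaquetteWalk

namespace Literature.Probability.RandomPlanarGeometry.SAW.YangBaxter

/-! ## § Parity (edition 7, b-step0 gen 16): the wound-walk dichotomy in decidable form

With the winding parity law of `YangBaxterSAWExcursionJordan.lean` (Part P, edition 3: for a class-`B2a` walk and a
free side `σ` of its rhombus, `AJ (midPt (r.side σ)) ≠ 0 ↔ Odd rayCount` — the excursion winds around the midpoint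
iff it crosses the lattice half-line behind `σ` an odd number of times) the WOUND/UNWOUND alternative of this file
becomes a parity: at the root's own plaquette `WE = excursionWinding ↔ Even rayCount` (both orientations of the
winding law; the ray count is invariant under reversal of the excursion, `ΩG.rayCount_rev`), hence on the open
range `VF_D(w.side σ, w) = 0 ↔` every class-`B2a` walk at `w` has an EVEN ray count, and `≠ 0 ↔` some class-`B2a`
walk has an ODD one — a finite, decidable combinatorial condition on `(D, w, σ)`.

### The ray count under reversal -/

namespace ΩG

open private rev_snd_nth rev_snd_length rev_firstHit
  from Literature.Probability.RandomPlanarGeometry.YangBaxterSAWGeneralDomain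
open private side_jOut len_eq from Literature.Probability.RandomPlanarGeometry.YangBaxterSAWExcursionJordan

variable {D : Set Face} {a : MidEdge} {r : Face} {ω : ΩG D a r} {hr : RootedFace D a r}

open scoped Classical in
/-- The ray count through the walk's indices: the number of indices `i ∈ [fh + 1, fh + Mv]` whose mid-edge lies
on the ray. [folklore] -/
private theorem rayCount_eq_card_filter_Icc (h : ω.IsB2a) (σ : Side) :
    ω.rayCount hr h σ = ((Finset.Icc (ω.2.firstHitG + 1) (ω.2.firstHitG + ω.Mv)).filter
      fun i => ∃ m : ℕ, ω.2.nth i = rayMid r σ m).card := by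
  unfold rayCount
  refine Finset.card_nbij' (fun j => ω.2.firstHitG + j + 1) (fun i => i - ω.2.firstHitG - 1) ?_ ?_ ?_ ?_
  · intro j hj
    simp only [Finset.mem_coe, Finset.mem_filter, Finset.mem_range, Finset.mem_Icc] at hj ⊢
    rw [← side_jOut (hr := hr) h hj.1]
    exact ⟨⟨by omega, by omega⟩, hj.2⟩
  · intro i hi
    simp only [Finset.mem_coe, Finset.mem_filter, Finset.mem_range, Finset.mem_Icc] at hi ⊢
    have hj : i - ω.2.firstHitG - 1 < ω.Mv := by omega
    refine ⟨hj, ?_⟩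
    rw [side_jOut (hr := hr) h hj, show ω.2.firstHitG + (i - ω.2.firstHitG - 1) + 1 = i by omega]
    exact hi.2
  · intro j _
    simp only
    omega
  · intro i hi
    simp only [Finset.mem_coe, Finset.mem_filter, Finset.mem_Icc] at hi
    simp only
    omega

/-- `nth` of the reversed walk beyond the first hit. [folklore] -/
private theorem rev_snd_nth_of_gt (h : ω.IsB2a) {i : ℕ} (hi : ω.2.firstHitG < i) (hi' : i ≤ ω.2.arcs.length) :
    (ω.rev hr).2.nth i = ω.2.nth (ω.2.arcs.length + ω.2.firstHitG + 1 - i) := by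
  rw [rev_snd_nth ω hr h hi', if_neg (by omega)]

/-- ★ **The ray count is invariant under reversal of the excursion** (the reversed companion crosses the same
mid-edges). [cite: Glazman2015WeightedSAW, Lemma 3.1 (proof, pp. 6–7: the classes of walks through a rhombus)] -/
theorem rayCount_rev (h : ω.IsB2a) (σ : Side) :
    (ω.rev hr).rayCount hr (ω.rev_isB2a hr h) σ = ω.rayCount hr h σ := by
  classical
  have hM := three_le_Mv hr h
  have hlen := len_eq h
  have hfh : (ω.rev hr).2.firstHitG = ω.2.firstHitG := rev_firstHit ω hr h
  have hL : (ω.rev hr).2.arcs.length = ω.2.arcs.length := rev_snd_length ω hr h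
  have hMv : (ω.rev hr).Mv = ω.Mv := by unfold Mv; rw [hL, hfh]
  rw [rayCount_eq_card_filter_Icc, rayCount_eq_card_filter_Icc, hfh, hMv]
  -- reflect the index range: `i ↦ len + fh + 1 - i`
  refine Finset.card_nbij' (fun i => ω.2.arcs.length + ω.2.firstHitG + 1 - i)
    (fun i => ω.2.arcs.length + ω.2.firstHitG + 1 - i) ?_ ?_ ?_ ?_
  · intro i hi
    simp only [Finset.mem_coe, Finset.mem_filter, Finset.mem_Icc] at hi ⊢
    refine ⟨⟨by omega, by omega⟩, ?_⟩
    rw [← rev_snd_nth_of_gt (hr := hr) h (i := i) (by omega) (by omega)]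
    exact hi.2
  · intro i hi
    simp only [Finset.mem_coe, Finset.mem_filter, Finset.mem_Icc] at hi ⊢
    refine ⟨⟨by omega, by omega⟩, ?_⟩
    rw [rev_snd_nth_of_gt (hr := hr) h (i := ω.2.arcs.length + ω.2.firstHitG + 1 - i) (by omega) (by omega),
      show ω.2.arcs.length + ω.2.firstHitG + 1 - (ω.2.arcs.length + ω.2.firstHitG + 1 - i) = i by omega]
    exact hi.2
  · intro i hi
    simp only [Finset.mem_coe, Finset.mem_filter, Finset.mem_Icc] at hi
    simp only
    omega
  · intro i hi
    simp only [Finset.mem_coe, Finset.mem_filter, Finset.mem_Icc] at hi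
    simp only
    omega


/-! ### At the root's own plaquette: unwound ⇔ even ray count -/

section Root

variable {D : Set Face} {w : Face} {σ : Side}

/-- ★★ **Unwound ⇔ even ray count.** For a walk of class `B2a` at the root's own plaquette `w` (root `w.side σ`):
`WE = excursionWinding(θ; σ, z₁, z₂)` — the excursion is UNWOUND — iff the excursion crosses the lattice half-line
behind the side `σ` of `w` an even number of times (winding law of the parent file in either orientation, the
winding parity law, and the reversal invariance of the ray count). [cite: GlazmanManolescu2019, Lemma 2.1 (statement, "in the form given in [Gl]")]
[cite: Glazman2015WeightedSAW, Lemma 3.1 (proof, pp. 6–7: the classes of walks through a rhombus)]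
[cite: CourantRobbins1958, Ch. V Appendix §2 (The Jordan Curve Theorem for Polygons: the even–odd rule)] -/
theorem WE_eq_excursionWinding_iff_even_rayCount (ω : ΩG D (w.side σ) w) (hr : RootedFace D (w.side σ) w)
    (h : ω.IsB2a) (θ : ℝ) :
    ω.WE (fun _ => θ) = excursionWinding θ σ (ω.z1 hr h) ω.1 ↔ Even (ω.rayCount hr h σ) := by
  have hd := ω.2.sides_distinctG hr h.1
  rw [ω.returnSide_of_isB2a h, ω.firstSideG_root] at hd
  have hσ1 : σ ≠ ω.z1 hr h := fun e => hd.1 e.symm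
  have hσ2 : σ ≠ ω.1 := fun e => hd.2.1 e.symm
  have h12 : ω.z1 hr h ≠ ω.1 := fun e => hd.2.2 e.symm
  rcases canon_or_swap hσ1 hσ2 h12 with hc | hc
  · have hc' : Canon ω.2.firstSideG (ω.z1 hr h) ω.1 := by rw [ω.firstSideG_root]; exact hc
    have e := ω.WE_eq_excursionWinding_add_two_AJ hr hc' (fun _ => θ)
    rw [ω.firstSideG_root] at e
    change ω.WE (fun _ => θ) = excursionWinding θ σ (ω.z1 hr h) ω.1 + 2 * ω.AJ hr h (toC (midPt (w.side σ))) at e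
    rw [← AJ_midPt_side_eq_zero_iff_even_rayCount h hσ1 hσ2, e]
    constructor
    · intro hh; linarith
    · intro hA; rw [hA]; ring
  · have h'' := ω.rev_isB2a hr h
    have hz1 : (ω.rev hr).z1 hr h'' = ω.1 := by unfold ΩG.z1; exact ω.rev_exitSide hr h
    have hfst : (ω.rev hr).1 = ω.z1 hr h := ω.rev_fst hr h
    have hc' : Canon (ω.rev hr).2.firstSideG ((ω.rev hr).z1 hr h'') (ω.rev hr).1 := by
      rw [ω.rev_firstSide hr h, ω.firstSideG_root, hz1, hfst]; exact hc
    have e := ω.WE_eq_excursionWinding_sub_two_AJ_rev hr (h := h) hc' (fun _ => θ)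
    rw [ω.firstSideG_root] at e
    change ω.WE (fun _ => θ) = excursionWinding θ σ (ω.z1 hr h) ω.1 -
      2 * (ω.rev hr).AJ hr h'' (toC (midPt (w.side σ))) at e
    rw [← rayCount_rev h σ,
      ← AJ_midPt_side_eq_zero_iff_even_rayCount (ω := ω.rev hr) h'' (by rw [hz1]; exact hσ2) (by rw [hfst]; exact hσ1), e]
    constructor
    · intro hh; linarith
    · intro hA; rw [hA]; ring

/-- ★★ **Wound ⇔ odd ray count** at the root's own plaquette. [cite: GlazmanManolescu2019, Lemma 2.1 (statement, "in the form given in [Gl]")]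
[cite: CourantRobbins1958, Ch. V Appendix §2 (The Jordan Curve Theorem for Polygons: the even–odd rule)] -/
theorem WE_ne_excursionWinding_iff_odd_rayCount (ω : ΩG D (w.side σ) w) (hr : RootedFace D (w.side σ) w)
    (h : ω.IsB2a) (θ : ℝ) :
    ω.WE (fun _ => θ) ≠ excursionWinding θ σ (ω.z1 hr h) ω.1 ↔ Odd (ω.rayCount hr h σ) := by
  rw [Ne, WE_eq_excursionWinding_iff_even_rayCount, Nat.not_even_iff_odd]

end Root

end ΩG

end Literature.Probability.RandomPlanarGeometry.SAW.YangBaxter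

/-! ### The vertex functional at the root's own plaquette: parity form -/

namespace Literature.Barriers.CriticalPhenomena.PlaquetteWalk

open Literature.Probability.RandomPlanarGeometry.SAW.YangBaxter
open Literature.Probability.RandomPlanarGeometry.SAW.YangBaxter.MidEdge
open Literature.Probability.RandomPlanarGeometry.SAW
open Real

/-- ★★★ **(Q2′) IN DECIDABLE FORM.** For every `θ ∈ (π/3, 2π/3)`, finite face list, plaquette `w` and side `σ` with
`w.side σ` non-interior: the Yang–Baxter vertex functional vanishes at the root's own plaquette iff EVERY class-`B2a`
walk at `w` crosses the lattice half-line behind the side `σ` of `w` an EVEN number of times.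
[cite: GlazmanManolescu2019, Lemma 2.1 (statement, "in the form given in [Gl]")]
[cite: Glazman2015WeightedSAW, Lemma 3.1 (proof, pp. 6–7: the classes of walks through a rhombus)]
[cite: CourantRobbins1958, Ch. V Appendix §2 (The Jordan Curve Theorem for Polygons: the even–odd rule)] -/
theorem vertexFunctional_printed_root_plaquette_eq_zero_iff_forall_even_rayCount {θ : ℝ}
    (hθ : θ ∈ Set.Ioo (π / 3) (2 * π / 3)) (Dl : List Face) (w : Face) (σ : Side)
    (hr : RootedFace (dom Dl) (w.side σ) w) :
    vertexFunctional (printedWeights θ) tFiveEighths (ybCoeff θ) Dl (w.side σ) w = 0 ↔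
      ∀ ω ∈ ΩG.setB2a (dom Dl) (w.side σ) w, ∀ h : ω.IsB2a, Even (ω.rayCount hr h σ) := by
  rw [vertexFunctional_printed_root_plaquette_eq_zero_iff_unwound hθ Dl w σ hr]
  refine forall₂_congr fun ω _ => forall_congr' fun h => ?_
  exact ΩG.WE_eq_excursionWinding_iff_even_rayCount ω hr h θ

/-- ★★★ **Failure of the identity, decidable form**: on the open range the vertex functional at the root's own
plaquette is NONZERO iff some class-`B2a` walk at `w` crosses the half-line behind `σ` an ODD number of times.
[cite: GlazmanManolescu2019, Lemma 2.1 (statement, "in the form given in [Gl]")]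
[cite: CourantRobbins1958, Ch. V Appendix §2 (The Jordan Curve Theorem for Polygons: the even–odd rule)] -/
theorem vertexFunctional_printed_root_plaquette_ne_zero_iff_exists_odd_rayCount {θ : ℝ}
    (hθ : θ ∈ Set.Ioo (π / 3) (2 * π / 3)) (Dl : List Face) (w : Face) (σ : Side)
    (hr : RootedFace (dom Dl) (w.side σ) w) :
    vertexFunctional (printedWeights θ) tFiveEighths (ybCoeff θ) Dl (w.side σ) w ≠ 0 ↔
      ∃ ω ∈ ΩG.setB2a (dom Dl) (w.side σ) w, ∃ h : ω.IsB2a, Odd (ω.rayCount hr h σ) := by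
  rw [Ne, vertexFunctional_printed_root_plaquette_eq_zero_iff_forall_even_rayCount hθ Dl w σ hr]
  push Not
  simp only [Nat.not_even_iff_odd]

/-- **Closed range** `θ ∈ [π/3, 2π/3]`: the vertex functional vanishes at the root's own plaquette iff every
class-`B2a` walk at `w` has an even ray count OR exterior weight `0` (the weight-zero clause matters only at the
endpoints, where `w₂(π/3) = 0`, `w₁(2π/3) = 0`). [cite: GlazmanManolescu2019, Lemma 2.1 (statement, "in the form given in [Gl]")]
[cite: CourantRobbins1958, Ch. V Appendix §2 (The Jordan Curve Theorem for Polygons: the even–odd rule)] -/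
theorem vertexFunctional_printed_root_plaquette_eq_zero_iff_forall_even_rayCount_or {θ : ℝ}
    (hθ : θ ∈ Set.Icc (π / 3) (2 * π / 3)) (Dl : List Face) (w : Face) (σ : Side)
    (hr : RootedFace (dom Dl) (w.side σ) w) :
    vertexFunctional (printedWeights θ) tFiveEighths (ybCoeff θ) Dl (w.side σ) w = 0 ↔
      ∀ ω ∈ ΩG.setB2a (dom Dl) (w.side σ) w, ∀ h : ω.IsB2a,
        Even (ω.rayCount hr h σ) ∨ ω.2.extWeight (fun _ => θ) w = 0 := by
  rw [vertexFunctional_printed_root_plaquette_eq_zero_iff hθ Dl w σ hr]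
  refine forall₂_congr fun ω _ => ?_
  rw [ΩG.woundMass_eq_zero_iff]
  refine forall_congr' fun h => ?_
  rw [ΩG.WE_eq_excursionWinding_iff_even_rayCount ω hr h θ]

end Literature.Barriers.CriticalPhenomena.PlaquetteWalk

/-! ### The odd-crossing criterion: a two-exit walk of `D ∖ {w}` with an odd ray count forces the failure -/

namespace Literature.Barriers.CriticalPhenomena.PlaquetteWalk

open Literature.Probability.RandomPlanarGeometry.SAW.YangBaxter
open Literature.Probability.RandomPlanarGeometry.SAW.YangBaxter.MidEdge
open Literature.Probability.RandomPlanarGeometry.SAW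
open Real

open private IsB2a IsB2 returnHit_memG returnHit_leG
  from Literature.Probability.RandomPlanarGeometry.YangBaxterSAWGeneralDomain
open private consWalk_mids from Literature.Barriers.CriticalPhenomena.PlaquetteWalkIsthmusRoot
open private side_jOut len_eq from Literature.Probability.RandomPlanarGeometry.YangBaxterSAWExcursionJordan

section OddCrossing

variable {Dl : List Face} {w : Face} {σ : Side}

/-- An interior mid-edge of a walk of `D ∖ {w}` is not a side of `w` (both its plaquettes are arc plaquettes of
the walk, hence `≠ w`). [folklore] -/
private theorem nth_interior_ne_side₇ {x y : MidEdge} (δ : YBWalk (dom (eraseFace Dl w)) x y) {j : ℕ}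
    (h0 : 0 < j) (hj : j < δ.arcs.length) (u : Side) : δ.nth j ≠ w.side u := by
  intro e
  obtain ⟨j', rfl⟩ : ∃ j', j = j' + 1 := ⟨j - 1, by omega⟩
  have hA := (YBWalk.arcFace_arcAt (γ := δ) (show j' < δ.arcs.length by omega)).2
  have hB := (YBWalk.arcFace_arcAt (γ := δ) hj).2
  have s1 := (YBWalk.side_sIn (γ := δ) (show j' < δ.arcs.length by omega)).2.1
  have s2 := (YBWalk.side_sIn (γ := δ) hj).1
  have hne := YBWalk.fc_succ_ne (γ := δ) hj
  have em : δ.nth (j' + 1) = δ.mids[j' + 1]'(by have := δ.length_eq; omega) :=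
    δ.nth_eq_getElem (by have := δ.length_eq; omega)
  have hwA : δ.fc j' ≠ w := by
    intro h; have := hA; rw [h] at this; simp [dom, eraseFace] at this
  have hwB : δ.fc (j' + 1) ≠ w := by
    intro h; have := hB; rw [h] at this; simp [dom, eraseFace] at this
  -- `w.side u = (fc j').side (sOut j') = (fc (j'+1)).side (sIn (j'+1))`
  have e1 : (δ.fc j').side (δ.sOut j') = w.side u := by rw [s1, ← em, e]
  have e2 : (δ.fc j').side (δ.sOut j') = (δ.fc (j' + 1)).side (δ.sIn (j' + 1)) := by rw [s1, s2]
  have hw' : w = nbr (δ.fc j') (δ.sOut j') := eq_nbr_of_side_eq_side e1 hwA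
  have hB' : δ.fc (j' + 1) = nbr (δ.fc j') (δ.sOut j') := eq_nbr_of_side_eq_side e2 hne
  exact hwB (hB'.trans hw'.symm)

/-- **The walk with the root arc prepended is of class `B2a` at `w`**: first arc `σ → z₁` in `w`, then the walk
`δ` of `D ∖ {w}` from `w.side z₁` to `w.side z₂`, which meets `∂w` again only at its end.
[cite: DuminilCopinSmirnov2012, proof of Lemma 1] [cite: GlazmanManolescu2019, §1] -/
theorem isB2a_consWalk (hw : w ∈ Dl) (hh : nbr w σ ∉ dom Dl) {z₁ z₂ : Side} (hz : z₁ ≠ z₂) (h1 : z₁ ≠ σ)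
    (δ : YBWalk (dom (eraseFace Dl w)) (w.side z₁) (w.side z₂)) :
    ΩG.IsB2a (⟨z₂, consWalk hw hh h1 δ⟩ : ΩG (dom Dl) (w.side σ) w) := by
  classical
  let γ : YBWalk (dom Dl) (w.side σ) (w.side z₂) := consWalk hw hh h1 δ
  have hmids : γ.mids = w.side σ :: δ.mids := consWalk_mids hw hh h1 δ
  have hlen : γ.arcs.length = δ.arcs.length + 1 := by
    have h1' := γ.length_eq
    have h2' := δ.length_eq
    rw [hmids, List.length_cons] at h1'
    omega
  have hδpos : 0 < δ.arcs.length := by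
    by_contra h0
    have e := δ.nth_length
    rw [show δ.arcs.length = 0 by omega, δ.nth_zero] at e
    exact hz (Face.side_injective w e)
  have hfh : γ.firstHitG (r := w) = 0 := by
    apply Nat.le_zero.1
    unfold YBWalk.firstHitG
    apply Finset.min'_le
    rw [YBWalk.mem_hitIdx]
    exact ⟨Nat.zero_le _, σ, γ.nth_zero⟩
  have hB2 : γ.firstHitG (r := w) + 1 < γ.arcs.length := by rw [hfh, hlen]; omega
  have hnth : ∀ i, i < δ.mids.length → γ.nth (i + 1) = δ.nth i := by
    intro i hi
    rw [γ.nth_eq_getElem (by rw [hmids, List.length_cons]; omega), δ.nth_eq_getElem hi]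
    simp [hmids]
  have key : γ.returnHitG (r := w) hB2 = γ.arcs.length := by
    have hm := returnHit_memG γ (r := w) hB2
    have hle := returnHit_leG γ (r := w) hB2
    by_contra hne
    have hlt : γ.returnHitG hB2 < γ.arcs.length := lt_of_le_of_ne hle hne
    obtain ⟨-, u, hu⟩ := (YBWalk.mem_hitIdx (γ := γ) (r := w)).1 hm.1
    have hR1 : 1 < γ.returnHitG hB2 := by have := hm.2; rw [hfh] at this; omega
    rw [show γ.returnHitG hB2 = (γ.returnHitG hB2 - 1) + 1 from by omega,
      hnth _ (by have := δ.length_eq; omega)] at hu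
    exact nth_interior_ne_side₇ δ (by omega) (by omega) u hu
  exact Exists.intro hB2 key

open scoped Classical in
/-- **The ray count of the prepended walk** is the number of mid-edges of `δ` on the ray behind the side `σ`
of `w`. [cite: CourantRobbins1958, Ch. V Appendix §2 (The Jordan Curve Theorem for Polygons: the even–odd rule)] -/
theorem rayCount_consWalk (hw : w ∈ Dl) (hh : nbr w σ ∉ dom Dl) {z₁ z₂ : Side} (hz : z₁ ≠ z₂) (h1 : z₁ ≠ σ)
    (δ : YBWalk (dom (eraseFace Dl w)) (w.side z₁) (w.side z₂)) (hr : RootedFace (dom Dl) (w.side σ) w) :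
    ΩG.rayCount (⟨z₂, consWalk hw hh h1 δ⟩ : ΩG (dom Dl) (w.side σ) w) hr (isB2a_consWalk hw hh hz h1 δ) σ =
      ((Finset.range (δ.arcs.length + 1)).filter fun i => ∃ m : ℕ, δ.nth i = rayMid w σ m).card := by
  set ω : ΩG (dom Dl) (w.side σ) w := ⟨z₂, consWalk hw hh h1 δ⟩ with hω
  have h := isB2a_consWalk hw hh hz h1 δ
  have hmids : ω.2.mids = w.side σ :: δ.mids := consWalk_mids hw hh h1 δ
  have hlen : ω.2.arcs.length = δ.arcs.length + 1 := by
    have h1' := ω.2.length_eq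
    have h2' := δ.length_eq
    rw [hmids, List.length_cons] at h1'
    omega
  have hfh : ω.2.firstHitG (r := w) = 0 := by
    apply Nat.le_zero.1
    unfold YBWalk.firstHitG
    apply Finset.min'_le
    rw [YBWalk.mem_hitIdx]
    exact ⟨Nat.zero_le _, σ, ω.2.nth_zero⟩
  have hMv : ω.Mv = δ.arcs.length + 1 := by unfold ΩG.Mv; rw [hlen, hfh]; rfl
  have hnth : ∀ i, i < δ.mids.length → ω.2.nth (i + 1) = δ.nth i := by
    intro i hi
    rw [ω.2.nth_eq_getElem (by rw [hmids, List.length_cons]; omega), δ.nth_eq_getElem hi]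
    simp [hmids]
  rw [ΩG.rayCount_eq_card_filter_Icc (hr := hr) h σ, hfh, hMv]
  refine Finset.card_nbij' (fun i => i - 1) (fun i => i + 1) ?_ ?_ ?_ ?_
  · intro i hi
    simp only [Finset.mem_coe, Finset.mem_filter, Finset.mem_Icc, Finset.mem_range] at hi ⊢
    refine ⟨by omega, ?_⟩
    rw [← hnth (i - 1) (by have := δ.length_eq; omega), show i - 1 + 1 = i by omega]
    exact hi.2
  · intro i hi
    simp only [Finset.mem_coe, Finset.mem_filter, Finset.mem_Icc, Finset.mem_range] at hi ⊢
    refine ⟨⟨by omega, by omega⟩, ?_⟩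
    rw [hnth i (by have := δ.length_eq; omega)]
    exact hi.2
  · intro i hi
    simp only [Finset.mem_coe, Finset.mem_filter, Finset.mem_Icc] at hi
    simp only
    omega
  · intro i _
    simp only
    omega

open scoped Classical in
/-- ★★★ **THE ODD-CROSSING CRITERION.** Let `w.side σ` be a boundary root of the finite face list `Dl` (the
plaquette across `σ` missing) and `θ ∈ (π/3, 2π/3)`. If SOME self-avoiding plaquette walk `δ` of `D ∖ {w}` joins
two distinct sides `z₁ ≠ z₂` of `w` (`z₁ ≠ σ`) and crosses the lattice half-line behind the side `σ` of `w` an ODD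
number of times, then the Yang–Baxter vertex identity FAILS at the root's own plaquette:
`VF_D(w.side σ, w) ≠ 0`. (The prepended walk is of class `B2a` and wound by the winding parity law; the
root-plaquette defect law.) In particular every simple closed chain of plaquettes of `D` through `w` winding once
around the hole cell behind `σ` forces the failure. [cite: GlazmanManolescu2019, Lemma 2.1 (statement, "in the form given in [Gl]")]
[cite: Glazman2015WeightedSAW, Lemma 3.1 (proof, pp. 6–7: the classes of walks through a rhombus)]
[cite: CourantRobbins1958, Ch. V Appendix §2 (The Jordan Curve Theorem for Polygons: the even–odd rule)] -/
theorem vertexFunctional_printed_root_plaquette_ne_zero_of_odd_crossing {θ : ℝ}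
    (hθ : θ ∈ Set.Ioo (π / 3) (2 * π / 3)) (Dl : List Face) (w : Face) (σ : Side) (hw : w ∈ Dl)
    (hh : nbr w σ ∉ dom Dl) (hr : RootedFace (dom Dl) (w.side σ) w) {z₁ z₂ : Side} (hz : z₁ ≠ z₂) (h1 : z₁ ≠ σ)
    (δ : YBWalk (dom (eraseFace Dl w)) (w.side z₁) (w.side z₂))
    (hodd : Odd ((Finset.range (δ.arcs.length + 1)).filter fun i => ∃ m : ℕ, δ.nth i = rayMid w σ m).card) :
    vertexFunctional (printedWeights θ) tFiveEighths (ybCoeff θ) Dl (w.side σ) w ≠ 0 := by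
  rw [vertexFunctional_printed_root_plaquette_ne_zero_iff_exists_odd_rayCount hθ Dl w σ hr]
  refine ⟨⟨z₂, consWalk hw hh h1 δ⟩, Finset.mem_filter.2 ⟨Finset.mem_univ _, isB2a_consWalk hw hh hz h1 δ⟩,
    isB2a_consWalk hw hh hz h1 δ, ?_⟩
  rw [rayCount_consWalk hw hh hz h1 δ hr]
  exact hodd

end OddCrossing

/-! ### The converse in walk language: the excursion of a wound walk is a two-exit walk with an odd ray count -/

section Excursion

open private arcFace_ne_of_isB2a from Literature.Probability.RandomPlanarGeometry.YangBaxterSAWGeneralDomain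
open private firstHitG_root from Literature.Probability.RandomPlanarGeometry.YangBaxterSAWUnwoundPlaquette

variable {Dl : List Face} {w : Face} {σ : Side}

/-- Membership in the domain with `w` removed. [folklore] -/
private theorem mem_dom_eraseFace₇ {f : Face} : f ∈ dom (eraseFace Dl w) ↔ f ∈ dom Dl ∧ f ≠ w := by
  simp [dom, eraseFace]

/-- **The excursion of a class-`B2a` walk at the root's own plaquette, as a walk of `D ∖ {w}`** from the exit
side to the return side (the walk with its first arc removed). [cite: GlazmanManolescu2019, Lemma 2.1 (statement, "in the form given in [Gl]")]
[cite: Glazman2015WeightedSAW, Lemma 3.1 (proof, pp. 6–7: the classes of walks through a rhombus)] -/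
def excursionWalk (ω : ΩG (dom Dl) (w.side σ) w) (hr : RootedFace (dom Dl) (w.side σ) w) (h : ω.IsB2a) :
    YBWalk (dom (eraseFace Dl w)) (w.side (ω.z1 hr h)) (w.side ω.1) :=
  (YBWalk.ofFn (D := dom (eraseFace Dl w)) (ω.2.arcs.length - 1) (fun i => ω.2.nth (i + 1))
    (fun i j hi hj e => by
      have hM := ΩG.three_le_Mv hr h
      have := ω.2.nth_inj (by unfold ΩG.Mv at hM; omega) (by unfold ΩG.Mv at hM; omega) e
      omega)
    (fun i hi => by
      have hM := ΩG.three_le_Mv hr h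
      have hfh : ω.2.firstHitG = 0 := firstHitG_root ω.2
      obtain ⟨f, hfD, hf⟩ := ω.2.arc_nth (i := i + 1) (by unfold ΩG.Mv at hM; omega)
      refine ⟨f, mem_dom_eraseFace₇.2 ⟨hfD, fun hfw => ?_⟩, hf⟩
      exact arcFace_ne_of_isB2a ω hr h (i := i + 1) (by unfold ΩG.Mv at hM; omega) (by rw [hfh]; omega)
        (by rw [hf, hfw]))
    (fun i hi => ω.2.chain_nth (by omega))
    (fun i j hi hj f hWE => ω.2.nc_nth (by omega) (by omega) f hWE)).cast
    (by
      have e := (ω.2.exitSide_specG hr (ω.fh_lt h)).1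
      rw [firstHitG_root ω.2, zero_add] at e
      exact e)
    (by
      have hM := ΩG.three_le_Mv hr h
      rw [show ω.2.arcs.length - 1 + 1 = ω.2.arcs.length by unfold ΩG.Mv at hM; omega]
      exact ω.2.nth_length)

/-- The excursion walk has one arc fewer. [folklore] -/
private theorem excursionWalk_length (ω : ΩG (dom Dl) (w.side σ) w) (hr : RootedFace (dom Dl) (w.side σ) w)
    (h : ω.IsB2a) : (excursionWalk ω hr h).arcs.length = ω.2.arcs.length - 1 := by
  rw [excursionWalk, YBWalk.length_arcs, YBWalk.cast_mids, YBWalk.ofFn_mids, List.length_ofFn]; omega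

/-- `nth` of the excursion walk. [folklore] -/
private theorem excursionWalk_nth (ω : ΩG (dom Dl) (w.side σ) w) (hr : RootedFace (dom Dl) (w.side σ) w)
    (h : ω.IsB2a) {i : ℕ} (hi : i ≤ ω.2.arcs.length - 1) : (excursionWalk ω hr h).nth i = ω.2.nth (i + 1) := by
  rw [YBWalk.nth_eq_getElem _ (by rw [excursionWalk, YBWalk.cast_mids, YBWalk.ofFn_mids, List.length_ofFn]; omega)]
  simp [excursionWalk, YBWalk.cast_mids, YBWalk.ofFn_mids, -List.ofFn_succ]

open scoped Classical in
/-- **The ray count of a class-`B2a` walk is the number of mid-edges of its excursion walk on the ray.**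
[cite: CourantRobbins1958, Ch. V Appendix §2 (The Jordan Curve Theorem for Polygons: the even–odd rule)] -/
theorem rayCount_eq_card_filter_excursionWalk (ω : ΩG (dom Dl) (w.side σ) w)
    (hr : RootedFace (dom Dl) (w.side σ) w) (h : ω.IsB2a) :
    ω.rayCount hr h σ = ((Finset.range ((excursionWalk ω hr h).arcs.length + 1)).filter
      fun i => ∃ m : ℕ, (excursionWalk ω hr h).nth i = rayMid w σ m).card := by
  have hM := ΩG.three_le_Mv hr h
  have hfh : ω.2.firstHitG = 0 := firstHitG_root ω.2
  have hMv : ω.Mv = ω.2.arcs.length := by unfold ΩG.Mv; rw [hfh]; rfl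
  rw [ΩG.rayCount_eq_card_filter_Icc (hr := hr) h σ, hfh, hMv, excursionWalk_length]
  refine Finset.card_nbij' (fun i => i - 1) (fun i => i + 1) ?_ ?_ ?_ ?_
  · intro i hi
    simp only [Finset.mem_coe, Finset.mem_filter, Finset.mem_Icc, Finset.mem_range] at hi ⊢
    refine ⟨by omega, ?_⟩
    rw [excursionWalk_nth ω hr h (by omega), show i - 1 + 1 = i by omega]
    exact hi.2
  · intro i hi
    simp only [Finset.mem_coe, Finset.mem_filter, Finset.mem_Icc, Finset.mem_range] at hi ⊢
    refine ⟨⟨by omega, by unfold ΩG.Mv at hM; omega⟩, ?_⟩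
    rw [← excursionWalk_nth ω hr h (by omega)]
    exact hi.2
  · intro i hi
    simp only [Finset.mem_coe, Finset.mem_filter, Finset.mem_Icc] at hi
    simp only
    omega
  · intro i _
    simp only
    omega

open scoped Classical in
/-- ★★★ **THE ODD-CROSSING CRITERION IS SHARP (walk form of (Q2′)).** For `θ ∈ (π/3, 2π/3)` and a boundary root
`w.side σ`: the Yang–Baxter vertex identity FAILS at the root's own plaquette (`VF_D(w.side σ, w) ≠ 0`) IF AND ONLY
IF some self-avoiding plaquette walk of `D ∖ {w}` joins two distinct sides `z₁ ≠ z₂` of `w` with `z₁ ≠ σ` and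
crosses the lattice half-line behind the side `σ` of `w` an ODD number of times.
[cite: GlazmanManolescu2019, Lemma 2.1 (statement, "in the form given in [Gl]")]
[cite: Glazman2015WeightedSAW, Lemma 3.1 (proof, pp. 6–7: the classes of walks through a rhombus)]
[cite: DuminilCopinSmirnov2012, proof of Lemma 1]
[cite: CourantRobbins1958, Ch. V Appendix §2 (The Jordan Curve Theorem for Polygons: the even–odd rule)] -/
theorem vertexFunctional_printed_root_plaquette_ne_zero_iff_exists_odd_crossing {θ : ℝ}
    (hθ : θ ∈ Set.Ioo (π / 3) (2 * π / 3)) (Dl : List Face) (w : Face) (σ : Side) (hw : w ∈ Dl)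
    (hh : nbr w σ ∉ dom Dl) (hr : RootedFace (dom Dl) (w.side σ) w) :
    vertexFunctional (printedWeights θ) tFiveEighths (ybCoeff θ) Dl (w.side σ) w ≠ 0 ↔
      ∃ z₁ z₂ : Side, ∃ _ : z₁ ≠ z₂, ∃ _ : z₁ ≠ σ, ∃ δ : YBWalk (dom (eraseFace Dl w)) (w.side z₁) (w.side z₂),
        Odd ((Finset.range (δ.arcs.length + 1)).filter fun i => ∃ m : ℕ, δ.nth i = rayMid w σ m).card := by
  constructor
  · intro hne
    obtain ⟨ω, -, h, hodd⟩ :=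
      (vertexFunctional_printed_root_plaquette_ne_zero_iff_exists_odd_rayCount hθ Dl w σ hr).1 hne
    have hd := ω.2.sides_distinctG hr h.1
    rw [ω.returnSide_of_isB2a h, ω.firstSideG_root] at hd
    -- hd : z1 ≠ σ ∧ ω.1 ≠ σ ∧ ω.1 ≠ z1
    refine ⟨ω.z1 hr h, ω.1, fun e => hd.2.2 e.symm, hd.1, excursionWalk ω hr h, ?_⟩
    rw [← rayCount_eq_card_filter_excursionWalk ω hr h]
    exact hodd
  · rintro ⟨z₁, z₂, hz, h1, δ, hodd⟩
    exact vertexFunctional_printed_root_plaquette_ne_zero_of_odd_crossing hθ Dl w σ hw hh hr hz h1 δ hodd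

end Excursion

/-! ### A boundary root plaquette is a rooted face -/

section Rooted

/-- A boundary root plaquette (the plaquette across `σ` missing) is a `RootedFace`. [cite: GlazmanManolescu2019, §2.1 (walks start on the boundary of the domain)] -/
theorem rootedFace_of_boundaryRoot (Dl : List Face) (w : Face) (σ : Side) (hw : w ∈ Dl) (hh : nbr w σ ∉ dom Dl) :
    RootedFace (dom Dl) (w.side σ) w := by
  refine ⟨(show w ∈ dom Dl from hw), fun hb => hh ?_⟩
  obtain ⟨x, y⟩ := w
  cases σ <;> simp [Face.side, MidEdge.faces, nbr] at hb ⊢ <;> tauto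

end Rooted

/-! ### The domain `D43`: a hole root whose wound excursions pass twice through one plaquette — the identity fails
for every `θ` of the open range, although the root lies on no simple plaquette cycle around its hole

The lane's counterexample to the naive «face-cycle» reading of the wound-walk dichotomy (HOME
`FINDING-YB-ENCIRCLING-CRITERION.md`, STATUS BLOCK 7; exact certificate `code/step0/g16/cyc/cex_exact_result.json`): the
43-face domain below, root `w.side N`, `w = (0,-1)`, hole cell `(0,0)`. Its face graph has 4 simple cycles through
`w`, none winding around the hole; yet the two-exit walk `δ43` of `D43 ∖ {w}` from `w.side S` to `w.side E` — down
the thin loop, through `f = (5,-1)`, around the outer ring, through `f` again — crosses the N-ray behind `w` exactly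
once, so the odd-crossing criterion applies. -/

section D43

/-- The domain `D43`: a thin loop `M` through `w = (0,-1)` and `f = (5,-1)` and an outer ring `P` attached to the
rest only through the S and E neighbours of `f`. [folklore] -/
def D43 : List Face :=
  [(0, -1), (0, -2), (1, -2), (2, -2), (3, -2), (3, -1), (4, -1), (5, -1), (5, 0), (4, 0), (3, 0), (2, 0), (1, 0),
    (1, -1), (5, -2), (5, -3), (5, -4), (4, -4), (3, -4), (2, -4), (1, -4), (0, -4), (-1, -4), (-2, -4), (-2, -3),
    (-2, -2), (-2, -1), (-2, 0), (-2, 1), (-2, 2), (-1, 2), (0, 2), (1, 2), (2, 2), (3, 2), (4, 2), (5, 2), (6, 2),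
    (7, 2), (7, 1), (7, 0), (7, -1), (6, -1)]

/-- The root plaquette of `D43`. [folklore] -/
def wD43 : Face := (0, -1)

/-- The 44 mid-edges of the odd-crossing two-exit walk of `D43 ∖ {w}` from `w.side S` to `w.side E` (the
excursion of the wound class-`B2a` walk: down the loop, twice through `f = (5,-1)`, around the ring). [folklore] -/
def δ43mids : List MidEdge :=
  [.slant 0 (-1), .vert 1 (-2), .vert 2 (-2), .vert 3 (-2), .slant 3 (-1), .vert 4 (-1), .vert 5 (-1), .slant 5 (-1),
    .slant 5 (-2), .slant 5 (-3), .vert 5 (-4), .vert 4 (-4), .vert 3 (-4), .vert 2 (-4), .vert 1 (-4), .vert 0 (-4),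
    .vert (-1) (-4), .slant (-2) (-3), .slant (-2) (-2), .slant (-2) (-1), .slant (-2) 0, .slant (-2) 1, .slant (-2) 2,
    .vert (-1) 2, .vert 0 2, .vert 1 2, .vert 2 2, .vert 3 2, .vert 4 2, .vert 5 2, .vert 6 2, .vert 7 2, .slant 7 2,
    .slant 7 1, .slant 7 0, .vert 7 (-1), .vert 6 (-1), .slant 5 0, .vert 5 0, .vert 4 0, .vert 3 0, .vert 2 0,
    .slant 1 0, .vert 1 (-1)]

/-- The mid-edge function of the walk. [folklore] -/
def δ43v (i : ℕ) : MidEdge := δ43mids.getD i (.vert 0 0)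

/-- The face carrying the two straight sides `W, E`, read off an arc, if it is a `W–E` arc. [folklore] -/
private def weFace : MidEdge × MidEdge → Option Face
  | (.vert a b, .vert a' b') => if a' = a + 1 ∧ b' = b then some (a, b) else if a = a' + 1 ∧ b = b' then some (a', b') else none
  | _ => none

/-- A `W–E` arc of `f` has `weFace = some f`. [folklore] -/
private theorem weFace_of_isWE {f : Face} {p : MidEdge × MidEdge} (h : IsWE f p) : weFace p = some f := by
  obtain ⟨a, b⟩ := f
  rcases h with rfl | rfl
  · simp [weFace, Face.side]
  · simp [weFace, Face.side]; omega

/-- The test «on the N-ray behind `wD43`» as a Boolean. [folklore] -/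
private def onRay43 : MidEdge → Bool
  | .vert a b => a == 0 && decide (0 ≤ b)
  | .slant _ _ => false

/-- The Boolean test is the ray membership. [folklore] -/
private theorem onRay43_iff (e : MidEdge) : (∃ m : ℕ, e = rayMid wD43 .N m) ↔ onRay43 e = true := by
  cases e with
  | vert a b =>
    simp only [rayMid, rayCell, raySide, Face.side, wD43, onRay43, Bool.and_eq_true, beq_iff_eq,
      decide_eq_true_eq, MidEdge.vert.injEq]
    constructor
    · rintro ⟨m, ha, hb⟩; exact ⟨ha, by omega⟩
    · rintro ⟨ha, hb⟩; exact ⟨b.toNat, ha, by omega⟩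
  | slant a b =>
    simp only [rayMid, rayCell, raySide, Face.side, wD43, onRay43]
    simp

/-- **The odd-crossing two-exit walk of `D43`.** [folklore] -/
def δ43 : YBWalk (dom (eraseFace D43 wD43)) (wD43.side .S) (wD43.side .E) :=
  (YBWalk.ofFn (D := dom (eraseFace D43 wD43)) 43 δ43v
    (by
      have key : ∀ i < 44, ∀ j < 44, δ43v i = δ43v j → i = j := by decide
      intro i j hi hj; exact key i (by omega) j (by omega))
    (by
      have key : ∀ i < 43, ∃ f ∈ (eraseFace D43 wD43), arcFace (δ43v i, δ43v (i + 1)) = some f := by decide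
      intro i hi
      obtain ⟨f, hf, e⟩ := key i hi
      exact ⟨f, hf, e⟩)
    (by
      have key : ∀ i < 42, arcFace (δ43v i, δ43v (i + 1)) ≠ arcFace (δ43v (i + 1), δ43v (i + 2)) := by decide
      intro i hi; exact key i (by omega))
    (by
      have key : ∀ i < 43, ∀ j < 43, ∀ f : Face, weFace (δ43v i, δ43v (i + 1)) = some f →
          ¬((δ43v j, δ43v (j + 1)) = (f.side .S, f.side .N) ∨ (δ43v j, δ43v (j + 1)) = (f.side .N, f.side .S)) := by
        decide
      intro i j hi hj f hWE hSN
      exact key i hi j hj f (weFace_of_isWE hWE) hSN)).cast (by decide) (by decide)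

/-- The walk has `43` arcs. [folklore] -/
private theorem δ43_length : δ43.arcs.length = 43 := by
  rw [δ43, YBWalk.length_arcs, YBWalk.cast_mids, YBWalk.ofFn_mids, List.length_ofFn]

/-- `nth` of the walk. [folklore] -/
private theorem δ43_nth {i : ℕ} (hi : i ≤ 43) : δ43.nth i = δ43v i := by
  rw [YBWalk.nth_eq_getElem _ (by rw [δ43, YBWalk.cast_mids, YBWalk.ofFn_mids, List.length_ofFn]; omega)]
  simp [δ43, YBWalk.cast_mids, YBWalk.ofFn_mids, -List.ofFn_succ]

open scoped Classical in
/-- **The walk crosses the N-ray behind `w` exactly once** (at its 24th mid-edge, the W side of the cell `(0, 2)`).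
[cite: CourantRobbins1958, Ch. V Appendix §2 (The Jordan Curve Theorem for Polygons: the even–odd rule)] -/
theorem δ43_rayCount :
    ((Finset.range (δ43.arcs.length + 1)).filter fun i => ∃ m : ℕ, δ43.nth i = rayMid wD43 .N m).card = 1 := by
  rw [δ43_length]
  have e : ((Finset.range (43 + 1)).filter fun i => ∃ m : ℕ, δ43.nth i = rayMid wD43 .N m) =
      (Finset.range (43 + 1)).filter fun i => onRay43 (δ43v i) = true := by
    apply Finset.filter_congr
    intro i hi
    rw [Finset.mem_range] at hi
    rw [δ43_nth (by omega), onRay43_iff]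
  rw [e]
  decide

/-- ★★★ **On `D43` the Yang–Baxter vertex identity FAILS at the root's own plaquette `(w, N)`, `w = (0,-1)`, for
EVERY `θ ∈ (π/3, 2π/3)`** — although `w` lies on NO simple plaquette cycle of `D43` winding around the hole cell
`(0, 0)` (the wound excursions pass twice through `f = (5,-1)`; HOME `code/step0/g16/cyc/`): the odd-crossing
criterion applied to the explicit 43-arc two-exit walk `δ43`. The naive face-cycle form of the cycle criterion is
thereby refuted in the kernel for the whole open range (the exact arithmetic of record covers `θ = π/2, 2π/3`; at
`θ = π/3` the functional vanishes, the double visit having weight `w₂(π/3) = 0`).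
[cite: GlazmanManolescu2019, Lemma 2.1 (statement, "in the form given in [Gl]")]
[cite: CourantRobbins1958, Ch. V Appendix §2 (The Jordan Curve Theorem for Polygons: the even–odd rule)] -/
theorem vertexFunctional_printed_D43_root_ne_zero {θ : ℝ} (hθ : θ ∈ Set.Ioo (π / 3) (2 * π / 3)) :
    vertexFunctional (printedWeights θ) tFiveEighths (ybCoeff θ) D43 (wD43.side .N) wD43 ≠ 0 := by
  have hw : wD43 ∈ D43 := by decide
  have hh : nbr wD43 .N ∉ dom D43 := by
    show nbr wD43 .N ∉ {f | f ∈ D43}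
    rw [Set.mem_setOf_eq]; decide
  refine vertexFunctional_printed_root_plaquette_ne_zero_of_odd_crossing hθ D43 wD43 .N hw hh
    (rootedFace_of_boundaryRoot D43 wD43 .N hw hh) (z₁ := .S) (z₂ := .E) (by decide) (by decide) δ43 ?_
  rw [δ43_rayCount]
  exact odd_one

end D43

/-! ## § Isthmus (edition 8, b-step0 gen 16): consistency with Part 4 at genuine isthmus hole roots -/

section Isthmus

/-- ★ **At every genuine isthmus hole root there is a class-`B2a` walk at the root plaquette of nonzero wound
mass** (Part 4's dichotomy `VF ≠ 0` combined with the root-plaquette law `VF = 0 ↔ wound mass 0`): the slot-walk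
world of Parts 1–4 and the excursion world of this file agree. [cite: GlazmanManolescu2019, Lemma 2.1 (statement, "in the form given in [Gl]")]
[cite: Glazman2015WeightedSAW, Lemma 3.1 (proof, pp. 6–7: the classes of walks through a rhombus)]
[cite: DuminilCopinSmirnov2012, proof of Lemma 1] -/
theorem exists_woundMass_ne_zero_of_isthmus_hole_root {θ : ℝ} (hθ : θ ∈ Set.Icc (π / 3) (2 * π / 3))
    (Dl : List Face) (w : Face) (σ : Side) (hw : w ∈ Dl) (hh : nbr w σ ∉ dom Dl)
    (hO : OuterRoot (dom Dl) (w.side σ.opp)) (hn : ¬OuterRoot (dom Dl) (w.side σ)) :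
    ∃ ω ∈ ΩG.setB2a (dom Dl) (w.side σ) w,
      ΩG.woundMass θ (rootedFace_of_boundaryRoot Dl w σ hw hh) ω ≠ 0 := by
  by_contra H
  push Not at H
  exact vertexFunctional_printed_isthmus_root_ne_zero_of_not_outerRoot hθ Dl w σ hw hh hO hn
    ((vertexFunctional_printed_root_plaquette_eq_zero_iff hθ Dl w σ (rootedFace_of_boundaryRoot Dl w σ hw hh)).2 H)

/-- ★ On the open range: at every genuine isthmus hole root some class-`B2a` walk at the root plaquette is WOUND
(`WE ≠ excursionWinding`), equivalently has an ODD ray count. [cite: GlazmanManolescu2019, Lemma 2.1 (statement, "in the form given in [Gl]")]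
[cite: CourantRobbins1958, Ch. V Appendix §2 (The Jordan Curve Theorem for Polygons: the even–odd rule)] -/
theorem exists_odd_rayCount_of_isthmus_hole_root {θ : ℝ} (hθ : θ ∈ Set.Ioo (π / 3) (2 * π / 3))
    (Dl : List Face) (w : Face) (σ : Side) (hw : w ∈ Dl) (hh : nbr w σ ∉ dom Dl)
    (hO : OuterRoot (dom Dl) (w.side σ.opp)) (hn : ¬OuterRoot (dom Dl) (w.side σ)) :
    ∃ ω ∈ ΩG.setB2a (dom Dl) (w.side σ) w, ∃ h : ω.IsB2a,
      Odd (ω.rayCount (rootedFace_of_boundaryRoot Dl w σ hw hh) h σ) :=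
  (vertexFunctional_printed_root_plaquette_ne_zero_iff_exists_odd_rayCount hθ Dl w σ
      (rootedFace_of_boundaryRoot Dl w σ hw hh)).1
    (vertexFunctional_printed_isthmus_root_ne_zero_of_not_outerRoot (Set.Ioo_subset_Icc_self hθ) Dl w σ hw hh hO hn)

end Isthmus

end Literature.Barriers.CriticalPhenomena.PlaquetteWalk

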